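import Literature.NumberTheory.LFunctions.SatheSelbergEulerProduct
import Literature.NumberTheory.LFunctions.LogZetaClassicalRegionBounds
import Literature.NumberTheory.LFunctions.ClassicalPsiErrorTerm
import Literature.NumberTheory.LFunctions.PrimeNumberTheoremErrorTerm
import Literature.NumberTheory.LFunctions.SatheSelbergEulerProductAtOne
import Literature.Analysis.Complex.HankelLoopIntegral
import HarnessLib

/-!
# The Selberg–Delange method for `∑ z^{ω(n)} n^{-s}`: Riesz means (MV Theorems 7.17–7.18 for `ω`)

Support file for the Sathe–Selberg formula (`SatheSelberg.lean`,
`Literature.NumberTheory.LFunctions.MontgomeryVaughan2007_exercise_7_4_3c`). Everything here is PROVED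
(theorems only). Following Montgomery–Vaughan §7.4 (proof of Theorem 7.17, pp. 177–178, and
Theorem 7.18) we prove, for the Riesz means of order one
`I_z(y) = ∑_{n ≤ y} z^{ω(n)} (y − n)` and uniformly for `‖z‖ ≤ R`,

  `I_z(y) = F(1, z) y² (log y)^{z−1} / (2 Γ(z)) + O_R(y² (log y)^{Re z − 2})`  (`y ≥ y₀(R)`),

where `F(s, z)` is the Euler product of `SatheSelbergEulerProduct.lean` (MV Exercise 7.4.1.3 (a)–(b)).
Deviations from the printed proof (shorter roads given the tree): Perron's formula of ORDER ONE
(absolutely convergent, `RieszMeanDirichlet.lean`) replaces the truncated Perron formula, so no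
divisor-sum bounds are needed; the keyhole `𝒞₂` around the branch point `s = 1` is rectangular
(`a = 1 + 1/log y` doubles as the right edge of the keyhole); `ζ(s)^z` for complex `z` is
`exp(z (logZeta₁ s − Log(s − 1)))` built on the tree's `logZeta₁`; Hankel's formula is used in the
truncated form `Literature.Analysis.Complex.Hankel.hankel_loop_sub_inv_Gamma_le`.

## References

* [MontgomeryVaughan2007] H. L. Montgomery, R. C. Vaughan, *Multiplicative Number Theory I*,
  CUP 2007, §7.4, Theorems 7.17–7.18 and their proofs (pp. 177–179), §7.4.1 Exercise 3.
-/

noncomputable section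

open Complex Set MeasureTheory Filter Topology Metric intervalIntegral
open scoped Real Interval

namespace Literature.NumberTheory.LFunctions

namespace SatheSelberg

open ClassicalPsiData (kernel)

/-! ### The complex powers `ζ(s)^z = exp(z (logZeta₁ s − Log(s − 1)))` -/

/-- `logZeta₁ 1 = 0` (the branch is real on the real axis and `ζ₁(1) = 1`). [folklore] -/
theorem logZeta₁_one : logZeta₁ 1 = 0 := by
  have h1 : ((1 : ℝ) : ℂ) ∈ zfrRegion := mem_zfrRegion_of_one_le_re (by simp)
  have him : (logZeta₁ 1).im = 0 := by simpa using logZeta₁_ofReal_im h1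
  have hre : (logZeta₁ 1).re = 0 := by
    have h := exp_re_logZeta₁_ofReal h1
    simp only [ofReal_one, riemannZeta₁_one, norm_one] at h
    exact Real.exp_eq_one_iff _ |>.1 h
  exact Complex.ext hre him

/-- Holomorphy of `s ↦ exp(z (logZeta₁ s − Log(s − 1)))` on the slit region. [folklore] -/
theorem differentiableOn_zetaPow (z : ℂ) :
    DifferentiableOn ℂ (fun s ↦ exp (z * (logZeta₁ s - log (s - 1)))) zfrSlitRegion := by
  intro s hs
  have hL : DifferentiableAt ℂ logZeta₁ s :=
    differentiableOn_logZeta₁.differentiableAt (isOpen_zfrRegion.mem_nhds hs.1)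
  have hlog : DifferentiableAt ℂ (fun w : ℂ ↦ log (w - 1)) s :=
    (differentiableAt_id.sub_const 1).clog hs.2
  exact (((hL.sub hlog).const_mul z).cexp).differentiableWithinAt

/-- On `Re s > 1` the power is that of the Euler product: `exp(z (logZeta₁ s − Log(s−1))) =
exp(z ∑_p −Log(1 − p^{−s}))`. [folklore] -/
theorem zetaPow_eq_of_one_lt_re (z : ℂ) {s : ℂ} (hs : 1 < s.re) :
    exp (z * (logZeta₁ s - log (s - 1))) = exp (z * eulerLogZeta s) := by
  rw [logZeta₁_eq_eulerLogZeta_add_log hs, add_sub_cancel_right]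

/-- `‖exp(z w)‖ ≤ exp(‖z‖ ‖w‖)`. [folklore] -/
theorem norm_exp_mul_le (z w : ℂ) : ‖exp (z * w)‖ ≤ Real.exp (‖z‖ * ‖w‖) := by
  calc ‖exp (z * w)‖ ≤ Real.exp ‖z * w‖ := norm_exp_le_exp_norm _
    _ = Real.exp (‖z‖ * ‖w‖) := by rw [norm_mul]

/-- **Bound in the region, `|t| ≥ 1`**: `‖ζ(s)^z‖ ≤ e^{C₀ ‖z‖} (log(|t| + 3))^{‖z‖}`.
[cite: MontgomeryVaughan2007, Theorem 6.7 and p. 178] -/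
theorem exists_norm_zetaPow_le_far :
    ∃ C₀ : ℝ, 0 ≤ C₀ ∧ ∀ z s : ℂ, s ∈ zfrRegion → 1 ≤ |s.im| →
      ‖exp (z * (logZeta₁ s - log (s - 1)))‖ ≤
        Real.exp (C₀ * ‖z‖) * Real.log (|s.im| + 3) ^ ‖z‖ := by
  obtain ⟨C₀, hC₀, h⟩ := exists_norm_logZeta_sub_log_le
  refine ⟨C₀, hC₀, fun z s hs ht ↦ ?_⟩
  have hℓ : 1 < Real.log (|s.im| + 3) := ZetaClassicalRegion.one_lt_log_abs_add_three s.im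
  calc ‖exp (z * (logZeta₁ s - log (s - 1)))‖
      ≤ Real.exp (‖z‖ * ‖logZeta₁ s - log (s - 1)‖) := norm_exp_mul_le _ _
    _ ≤ Real.exp (‖z‖ * (Real.log (Real.log (|s.im| + 3)) + C₀)) := by
        rw [Real.exp_le_exp]
        exact mul_le_mul_of_nonneg_left (h s hs ht) (norm_nonneg z)
    _ = Real.exp (C₀ * ‖z‖) * Real.log (|s.im| + 3) ^ ‖z‖ := by
        rw [Real.rpow_def_of_pos (by linarith), ← Real.exp_add]
        congr 1; ring

/-- **Bound near `s = 1`**: for `|t| ≤ 1`, `1 − zfrWidth 1/2 ≤ σ ≤ 2`, `s ≠ 1`: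
`‖ζ(s)^z‖ ≤ e^{(M + π)‖z‖} · exp(‖z‖ |log ‖s − 1‖|)`. [cite: MontgomeryVaughan2007, p. 178] -/
theorem exists_norm_zetaPow_le_near :
    ∃ M : ℝ, 0 ≤ M ∧ ∀ z s : ℂ, |s.im| ≤ 1 → 1 - zfrWidth 1 / 2 ≤ s.re → s.re ≤ 2 → s ≠ 1 →
      ‖exp (z * (logZeta₁ s - log (s - 1)))‖ ≤
        Real.exp ((M + π) * ‖z‖) * Real.exp (‖z‖ * |Real.log ‖s - 1‖|) := by
  obtain ⟨M, hM, h⟩ := exists_norm_logZeta₁_le_near_one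
  refine ⟨M, hM, fun z s ht hre1 hre2 hs1 ↦ ?_⟩
  have hne : s - 1 ≠ 0 := sub_ne_zero.2 hs1
  have hlog : ‖log (s - 1)‖ ≤ |Real.log ‖s - 1‖| + π := by
    have h1 := Complex.norm_le_abs_re_add_abs_im (log (s - 1))
    rw [Complex.log_re, Complex.log_im] at h1
    have h2 : |(s - 1).arg| ≤ π := abs_arg_le_pi _
    linarith
  calc ‖exp (z * (logZeta₁ s - log (s - 1)))‖
      ≤ Real.exp (‖z‖ * ‖logZeta₁ s - log (s - 1)‖) := norm_exp_mul_le _ _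
    _ ≤ Real.exp (‖z‖ * (M + (|Real.log ‖s - 1‖| + π))) := by
        rw [Real.exp_le_exp]
        refine mul_le_mul_of_nonneg_left ?_ (norm_nonneg z)
        exact (norm_sub_le _ _).trans (add_le_add (h s ht hre1 hre2) hlog)
    _ = Real.exp ((M + π) * ‖z‖) * Real.exp (‖z‖ * |Real.log ‖s - 1‖|) := by
        rw [← Real.exp_add]; congr 1; ring

/-! ### The continued integrand `Ψ(s) = y^{1+s} F(s, z) ζ(s)^z /(s(s+1))` -/

/-- Points of the slit region have `Re s > 1/2`, hence `s ≠ 0`, `s ≠ −1`. [folklore] -/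
theorem re_pos_of_mem_zfrSlitRegion {s : ℂ} (hs : s ∈ zfrSlitRegion) : 0 < s.re := by
  linarith [half_lt_re_of_mem_zfrRegion hs.1]

/-- **Holomorphy of the integrand** `Ψ(s) = y^{1+s} · F(s, z) ζ(s)^z · 1/(s(s+1))` on the slit
region (`y > 0`). [cite: MontgomeryVaughan2007, §7.4 p. 178] -/
theorem differentiableOn_integrand {y : ℝ} (hy : 0 < y) (z : ℂ) :
    DifferentiableOn ℂ (fun s ↦ (y : ℂ) ^ (1 + s) *
      (selbergF s z * exp (z * (logZeta₁ s - log (s - 1)))) * kernel s) zfrSlitRegion := by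
  intro s hs
  have hσ := re_pos_of_mem_zfrSlitRegion hs
  have hF : DifferentiableAt ℂ (fun s ↦ selbergF s z) s :=
    (differentiableOn_selbergF z).differentiableAt
      ((isOpen_lt continuous_const continuous_re).mem_nhds (half_lt_re_of_mem_zfrRegion hs.1))
  have hZ : DifferentiableAt ℂ (fun s ↦ exp (z * (logZeta₁ s - log (s - 1)))) s :=
    (differentiableOn_zetaPow z).differentiableAt (isOpen_zfrSlitRegion.mem_nhds hs)
  have hΦ := ClassicalPsiData.differentiableAt_Phi (F := fun s ↦ selbergF s z *
    exp (z * (logZeta₁ s - log (s - 1)))) hy (hF.mul hZ) hσ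
  exact hΦ.differentiableWithinAt

/-! ### Perron's formula of order one for `I_z(y) = ∑_{n ≤ y} z^{ω(n)} (y − n)` -/

/-- **Perron's formula for `I_z(y)` with the continued integrand**: for `y > 0`, `a > 1`,
`∑_{n ≤ y} z^{ω(n)}(y − n) = (1/2π) ∫ Ψ(a + it) dt` with
`Ψ(s) = y^{1+s} F(s,z) exp(z(logZeta₁ s − Log(s−1)))/(s(s+1))` (on `σ = a > 1` the Dirichlet
series equals `F(s,z) ζ(s)^z`). [cite: MontgomeryVaughan2007, §5.1 (5.19) and §7.4.1 Exercise 3(b)] -/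
theorem rieszMean_eq_integral {y : ℝ} (hy : 0 < y) (z : ℂ) {a : ℝ} (ha : 1 < a) :
    ∑ n ∈ Finset.Ioc 0 ⌊y⌋₊, omegaCoeff z n * ((y : ℂ) - n) =
      (1 / (2 * π) : ℂ) * ∫ t : ℝ, (y : ℂ) ^ (1 + ((a : ℂ) + t * I)) *
        (selbergF ((a : ℂ) + t * I) z * exp (z * (logZeta₁ ((a : ℂ) + t * I) -
          log (((a : ℂ) + t * I) - 1)))) * kernel ((a : ℂ) + t * I) := by
  have ha' : 1 < ((a : ℂ)).re := by simpa using ha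
  have hsum : LSeriesSummable (omegaCoeff z) (a : ℂ) := LSeriesSummable_omegaCoeff z ha'
  rw [RieszMean.sum_mul_sub_eq_integral_LSeries (omegaCoeff z) hy (by linarith) hsum]
  congr 1
  refine integral_congr_ae (Eventually.of_forall fun t ↦ ?_)
  have hat : 1 < ((a : ℂ) + t * I).re := by simpa using ha
  simp only [kernel]
  rw [LSeries_omegaCoeff_eq z hat, zetaPow_eq_of_one_lt_re z hat]

/-- Integrability of the continued integrand on the line `σ = a > 1`. [folklore] -/
theorem integrable_integrand_line {y : ℝ} (hy : 0 < y) (z : ℂ) {a : ℝ} (ha : 1 < a) :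
    Integrable fun t : ℝ ↦ (y : ℂ) ^ (1 + ((a : ℂ) + t * I)) *
      (selbergF ((a : ℂ) + t * I) z * exp (z * (logZeta₁ ((a : ℂ) + t * I) -
        log (((a : ℂ) + t * I) - 1)))) * kernel ((a : ℂ) + t * I) := by
  have ha' : 1 < ((a : ℂ)).re := by simpa using ha
  have hsum : LSeriesSummable (omegaCoeff z) (a : ℂ) := LSeriesSummable_omegaCoeff z ha'
  refine (ClassicalPsiData.integrable_cpow_mul_LSeries_mul_kernel (omegaCoeff z) hy
    (by linarith) hsum).congr (Eventually.of_forall fun t ↦ ?_)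
  have hat : 1 < ((a : ℂ) + t * I).re := by simpa using ha
  simp only
  rw [LSeries_omegaCoeff_eq z hat, zetaPow_eq_of_one_lt_re z hat]

/-! ### The keyhole deformation (two Cauchy rectangles) -/

/-- **Deforming the line `σ = a` onto the keyhole contour.** Let `Ψ` be holomorphic on the two
closed rectangles `[b, a] × [δ, T]` and `[b, a] × [−T, −δ]` and integrable along `σ = a`. Then
`i ∫_ℝ Ψ(a + it) dt = i·(tails |t| ≥ T) + i·(left verticals on σ = b, δ ≤ |t| ≤ T)
 + (∫_b^a Ψ(x + iT) dx − ∫_b^a Ψ(x − iT) dx) + [∫_b^a Ψ(x − iδ) dx + i ∫_{−δ}^{δ} Ψ(a + it) dt − ∫_b^a Ψ(x + iδ) dx]`,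
the last bracket being the integral over the rectangular Hankel loop around `s = 1`
(MV's `𝒞₁ ∪ 𝒞₂ ∪ 𝒞₃`, p. 178). [cite: MontgomeryVaughan2007, §7.4 p. 178] -/
theorem integral_line_eq_keyhole {Ψ : ℂ → ℂ} {a b δ T : ℝ} (hδT : δ ≤ T) (hba : b ≤ a)
    (hdiff_top : DifferentiableOn ℂ Ψ (Icc b a ×ℂ Icc δ T))
    (hdiff_bot : DifferentiableOn ℂ Ψ (Icc b a ×ℂ Icc (-T) (-δ)))
    (hint : Integrable fun t : ℝ ↦ Ψ ((a : ℂ) + t * I)) :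
    I * ∫ t : ℝ, Ψ ((a : ℂ) + t * I) =
      I * ((∫ t in Iic (-T), Ψ ((a : ℂ) + t * I)) + ∫ t in Ioi T, Ψ ((a : ℂ) + t * I)) +
      I * ((∫ t in (-T)..(-δ), Ψ ((b : ℂ) + t * I)) + ∫ t in δ..T, Ψ ((b : ℂ) + t * I)) +
      ((∫ x in b..a, Ψ ((x : ℂ) + T * I)) - ∫ x in b..a, Ψ ((x : ℂ) + ((-T : ℝ) : ℂ) * I)) +
      ((∫ x in b..a, Ψ ((x : ℂ) + ((-δ : ℝ) : ℂ) * I)) + I * (∫ t in (-δ)..δ, Ψ ((a : ℂ) + t * I)) -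
        ∫ x in b..a, Ψ ((x : ℂ) + δ * I)) := by
  -- split the line integral at `−T`, `−δ`, `δ`, `T`
  have hs1 := intervalIntegral.integral_Iic_add_Ioi (b := -T) hint.integrableOn hint.integrableOn
  have hs2 := intervalIntegral.integral_interval_add_Ioi (a := -T) (b := -δ)
    hint.integrableOn hint.integrableOn
  have hs3 := intervalIntegral.integral_interval_add_Ioi (a := -δ) (b := δ)
    hint.integrableOn hint.integrableOn
  have hs4 := intervalIntegral.integral_interval_add_Ioi (a := δ) (b := T)
    hint.integrableOn hint.integrableOn
  -- Cauchy–Goursat on the top rectangle `[b, a] × [δ, T]`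
  have htop := Complex.integral_boundary_rect_eq_zero_of_differentiableOn Ψ ⟨b, δ⟩ ⟨a, T⟩
    (by rw [uIcc_of_le hba, uIcc_of_le hδT]; exact hdiff_top)
  -- Cauchy–Goursat on the bottom rectangle `[b, a] × [−T, −δ]`
  have hbot := Complex.integral_boundary_rect_eq_zero_of_differentiableOn Ψ ⟨b, -T⟩ ⟨a, -δ⟩
    (by rw [uIcc_of_le hba, uIcc_of_le (by linarith : -T ≤ -δ)]; exact hdiff_bot)
  dsimp only at htop hbot
  simp only [smul_eq_mul] at htop hbot
  rw [← hs1, ← hs2, ← hs3, ← hs4]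
  linear_combination htop + hbot


/-! ### Two elementary growth lemmas -/

/-- `(log(t + 3))^R ≤ K_R t^{1/2}` for `t ≥ 1`. [folklore] -/
theorem exists_rpow_log_le (R : ℝ) :
    ∃ K : ℝ, 0 < K ∧ ∀ t : ℝ, 1 ≤ t → Real.log (t + 3) ^ R ≤ K * t ^ (1 / 2 : ℝ) := by
  set R' : ℝ := max R 1 with hR'
  have hR'1 : 1 ≤ R' := le_max_right _ _
  have hR'0 : 0 < R' := by linarith
  set ε : ℝ := 1 / (2 * R') with hε
  have hε0 : 0 < ε := by positivity
  refine ⟨2 * ε ^ (-R'), by positivity, fun t ht ↦ ?_⟩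
  have ht0 : 0 < t := by linarith
  have hlog1 : 1 < Real.log (t + 3) := by
    have := ZetaClassicalRegion.one_lt_log_abs_add_three t
    rwa [abs_of_pos ht0] at this
  -- `(log(t+3))^R ≤ (log(t+3))^{R'}`
  have h1 : Real.log (t + 3) ^ R ≤ Real.log (t + 3) ^ R' :=
    Real.rpow_le_rpow_of_exponent_le hlog1.le (le_max_left _ _)
  -- `log(t+3) ≤ (t+3)^ε/ε`
  have h2 : Real.log (t + 3) ≤ (t + 3) ^ ε / ε := Real.log_le_rpow_div (by linarith) hε0
  have h3 : Real.log (t + 3) ^ R' ≤ ((t + 3) ^ ε / ε) ^ R' :=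
    Real.rpow_le_rpow (by linarith) h2 hR'0.le
  have h4 : ((t + 3) ^ ε / ε) ^ R' = ε ^ (-R') * (t + 3) ^ (1 / 2 : ℝ) := by
    rw [div_eq_mul_inv, Real.mul_rpow (Real.rpow_nonneg (by linarith) _) (by positivity),
      ← Real.rpow_mul (by linarith), Real.inv_rpow hε0.le, ← Real.rpow_neg hε0.le]
    have : ε * R' = 1 / 2 := by rw [hε]; field_simp
    rw [this, mul_comm]
  have h5 : (t + 3) ^ (1 / 2 : ℝ) ≤ 2 * t ^ (1 / 2 : ℝ) := by
    calc (t + 3) ^ (1 / 2 : ℝ) ≤ (4 * t) ^ (1 / 2 : ℝ) :=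
          Real.rpow_le_rpow (by linarith) (by linarith) (by norm_num)
      _ = (4 : ℝ) ^ (1 / 2 : ℝ) * t ^ (1 / 2 : ℝ) := Real.mul_rpow (by norm_num) ht0.le
      _ = 2 * t ^ (1 / 2 : ℝ) := by
          rw [show (4 : ℝ) = 2 ^ 2 by norm_num, ← Real.rpow_natCast, ← Real.rpow_mul (by norm_num)]
          norm_num
  have hε' : 0 ≤ ε ^ (-R') := Real.rpow_nonneg hε0.le _
  calc Real.log (t + 3) ^ R ≤ ε ^ (-R') * (t + 3) ^ (1 / 2 : ℝ) := by rw [← h4]; exact h1.trans h3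
    _ ≤ ε ^ (-R') * (2 * t ^ (1 / 2 : ℝ)) := mul_le_mul_of_nonneg_left h5 hε'
    _ = 2 * ε ^ (-R') * t ^ (1 / 2 : ℝ) := by ring

/-- `L^A e^{−c√L} ≤ C` for `L ≥ 1` (`c > 0`), in the form `L^A ≤ C e^{c√L}`, from the Taylor bound
`c^{2k} L^k/(2k)! ≤ e^{c√L}`. [folklore] -/
theorem exists_rpow_le_exp_sqrt (A : ℝ) {c : ℝ} (hc : 0 < c) :
    ∃ C : ℝ, 0 < C ∧ ∀ L : ℝ, 1 ≤ L → L ^ A ≤ C * Real.exp (c * Real.sqrt L) := by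
  set k : ℕ := ⌈A⌉₊ with hk
  have hAk : A ≤ k := Nat.le_ceil A
  have hfact : (0 : ℝ) < (2 * k).factorial := by exact_mod_cast Nat.factorial_pos _
  refine ⟨(2 * k).factorial / c ^ (2 * k), by positivity, fun L hL ↦ ?_⟩
  have hL0 : 0 ≤ L := by linarith
  have h := pow_mul_pow_div_factorial_le_exp_sqrt hc.le hL0 k
  rw [div_le_iff₀ hfact] at h
  have hck : 0 < c ^ (2 * k) := pow_pos hc _
  calc L ^ A ≤ L ^ (k : ℝ) := Real.rpow_le_rpow_of_exponent_le hL hAk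
    _ = L ^ k := Real.rpow_natCast L k
    _ = (c ^ (2 * k) * L ^ k) / c ^ (2 * k) := by field_simp
    _ ≤ (Real.exp (c * Real.sqrt L) * (2 * k).factorial) / c ^ (2 * k) := by gcongr
    _ = (2 * k).factorial / c ^ (2 * k) * Real.exp (c * Real.sqrt L) := by ring

/-! ### Pointwise bounds for the integrand on the contour -/

/-- The modulus of the integrand: `‖Ψ(s)‖ = y^{1+σ} ‖F(s,z)‖ ‖ζ(s)^z‖ ‖1/(s(s+1))‖`. [folklore] -/
theorem norm_integrand_eq {y : ℝ} (hy : 0 < y) (z s : ℂ) :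
    ‖(y : ℂ) ^ (1 + s) * (selbergF s z * exp (z * (logZeta₁ s - log (s - 1)))) * kernel s‖ =
      y ^ (1 + s.re) * (‖selbergF s z‖ * ‖exp (z * (logZeta₁ s - log (s - 1)))‖) * ‖kernel s‖ := by
  rw [norm_mul, norm_mul, norm_mul, norm_cpow_eq_rpow_re_of_pos hy]
  simp

/-- **Far from `s = 1`** (`|t| ≥ 1`, `s` in the region, `σ ≥ 3/4`, `‖z‖ ≤ R`):
`‖Ψ(s)‖ ≤ y^{1+σ} · B e^{C₀R} (log(|t|+3))^R / t²`. [cite: MontgomeryVaughan2007, §7.4 p. 178] -/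
theorem exists_norm_integrand_le_far (R : ℝ) :
    ∃ A : ℝ, 0 ≤ A ∧ ∀ (y : ℝ), 0 < y → ∀ z s : ℂ, ‖z‖ ≤ R → s ∈ zfrRegion → 3 / 4 ≤ s.re →
      1 ≤ |s.im| →
      ‖(y : ℂ) ^ (1 + s) * (selbergF s z * exp (z * (logZeta₁ s - log (s - 1)))) * kernel s‖ ≤
        y ^ (1 + s.re) * (A * Real.log (|s.im| + 3) ^ R / s.im ^ 2) := by
  obtain ⟨B, hB, hF⟩ := exists_bound_selbergF (by norm_num : (1 : ℝ) / 2 < 3 / 4) R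
  obtain ⟨C₀, hC₀, hZ⟩ := exists_norm_zetaPow_le_far
  refine ⟨B * Real.exp (C₀ * R), by positivity, fun y hy z s hz hs hσ ht ↦ ?_⟩
  have hℓ : 1 < Real.log (|s.im| + 3) := ZetaClassicalRegion.one_lt_log_abs_add_three s.im
  have him : s.im ≠ 0 := fun h ↦ by rw [h, abs_zero] at ht; linarith
  rw [norm_integrand_eq hy]
  have h1 : ‖selbergF s z‖ ≤ B := hF s z hσ hz
  have h2 : ‖exp (z * (logZeta₁ s - log (s - 1)))‖ ≤ Real.exp (C₀ * R) * Real.log (|s.im| + 3) ^ R := by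
    calc ‖exp (z * (logZeta₁ s - log (s - 1)))‖
        ≤ Real.exp (C₀ * ‖z‖) * Real.log (|s.im| + 3) ^ ‖z‖ := hZ z s hs ht
      _ ≤ Real.exp (C₀ * R) * Real.log (|s.im| + 3) ^ R :=
          mul_le_mul (Real.exp_le_exp.2 (mul_le_mul_of_nonneg_left hz hC₀))
            (Real.rpow_le_rpow_of_exponent_le hℓ.le hz)
            (Real.rpow_nonneg (by linarith) _) (Real.exp_pos _).le
  have h3 : ‖kernel s‖ ≤ 1 / s.im ^ 2 := ClassicalPsiData.norm_kernel_le_inv_sq him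
  have hy' : 0 ≤ y ^ (1 + s.re) := Real.rpow_nonneg hy.le _
  calc y ^ (1 + s.re) * (‖selbergF s z‖ * ‖exp (z * (logZeta₁ s - log (s - 1)))‖) * ‖kernel s‖
      ≤ y ^ (1 + s.re) * (B * (Real.exp (C₀ * R) * Real.log (|s.im| + 3) ^ R)) * (1 / s.im ^ 2) := by
        gcongr
    _ = y ^ (1 + s.re) * (B * Real.exp (C₀ * R) * Real.log (|s.im| + 3) ^ R / s.im ^ 2) := by ring

/-- **Near `s = 1`** (`|t| ≤ 1`, `1 − zfrWidth 1/2 ≤ σ ≤ 2`, `σ ≥ 3/4`, `δ ≤ ‖s − 1‖ ≤ 2`, `‖z‖ ≤ R`):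
`‖Ψ(s)‖ ≤ y^{1+σ} · 4 B e^{(M+π)R} (2/δ)^R`. [cite: MontgomeryVaughan2007, §7.4 p. 178] -/
theorem exists_norm_integrand_le_near (R : ℝ) (hR : 0 ≤ R) :
    ∃ A : ℝ, 0 ≤ A ∧ ∀ (y : ℝ), 0 < y → ∀ (δ : ℝ), 0 < δ → δ ≤ 1 → ∀ z s : ℂ, ‖z‖ ≤ R →
      |s.im| ≤ 1 → 1 - zfrWidth 1 / 2 ≤ s.re → s.re ≤ 2 → 3 / 4 ≤ s.re → δ ≤ ‖s - 1‖ → ‖s - 1‖ ≤ 2 →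
      ‖(y : ℂ) ^ (1 + s) * (selbergF s z * exp (z * (logZeta₁ s - log (s - 1)))) * kernel s‖ ≤
        y ^ (1 + s.re) * (A * (2 / δ) ^ R) := by
  obtain ⟨B, hB, hF⟩ := exists_bound_selbergF (by norm_num : (1 : ℝ) / 2 < 3 / 4) R
  obtain ⟨M, hM, hZ⟩ := exists_norm_zetaPow_le_near
  refine ⟨4 * B * Real.exp ((M + π) * R), by positivity,
    fun y hy δ hδ hδ1 z s hz ht hre1 hre2 hσ hd1 hd2 ↦ ?_⟩
  have hs1 : s ≠ 1 := by
    intro h; rw [h, sub_self, norm_zero] at hd1; linarith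
  rw [norm_integrand_eq hy]
  have h1 : ‖selbergF s z‖ ≤ B := hF s z hσ hz
  -- `|log ‖s − 1‖| ≤ log(2/δ)`
  have hlog : |Real.log ‖s - 1‖| ≤ Real.log (2 / δ) := by
    have hpos : 0 < ‖s - 1‖ := lt_of_lt_of_le hδ hd1
    rw [abs_le]
    constructor
    · rw [Real.log_div (by norm_num) hδ.ne', neg_le]
      have : Real.log δ ≤ Real.log ‖s - 1‖ := Real.log_le_log hδ hd1
      have h2 : 0 ≤ Real.log 2 := Real.log_nonneg (by norm_num)
      linarith
    · have : Real.log ‖s - 1‖ ≤ Real.log 2 := Real.log_le_log hpos hd2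
      have h0 : Real.log 2 ≤ Real.log (2 / δ) :=
        Real.log_le_log (by norm_num) (by rw [le_div_iff₀ hδ]; nlinarith)
      linarith
  have h2 : ‖exp (z * (logZeta₁ s - log (s - 1)))‖ ≤ Real.exp ((M + π) * R) * (2 / δ) ^ R := by
    calc ‖exp (z * (logZeta₁ s - log (s - 1)))‖
        ≤ Real.exp ((M + π) * ‖z‖) * Real.exp (‖z‖ * |Real.log ‖s - 1‖|) := hZ z s ht hre1 hre2 hs1
      _ ≤ Real.exp ((M + π) * R) * Real.exp (R * Real.log (2 / δ)) :=
          mul_le_mul (Real.exp_le_exp.2 (mul_le_mul_of_nonneg_left hz (by positivity)))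
            (Real.exp_le_exp.2 (mul_le_mul hz hlog (abs_nonneg _) hR))
            (Real.exp_pos _).le (Real.exp_pos _).le
      _ = Real.exp ((M + π) * R) * (2 / δ) ^ R := by
          rw [Real.rpow_def_of_pos (by positivity), mul_comm R]
  have h3 : ‖kernel s‖ ≤ 4 := by
    have h := ClassicalPsiData.norm_kernel_le_four_div (σ := s.re) (by linarith) s.im
    rw [show ((s.re : ℂ) + (s.im : ℂ) * I) = s from Complex.ext (by simp) (by simp)] at h
    refine h.trans ?_
    rw [mul_inv_le_iff₀ (by positivity)]
    nlinarith [sq_nonneg s.im]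
  have hy' : 0 ≤ y ^ (1 + s.re) := Real.rpow_nonneg hy.le _
  calc y ^ (1 + s.re) * (‖selbergF s z‖ * ‖exp (z * (logZeta₁ s - log (s - 1)))‖) * ‖kernel s‖
      ≤ y ^ (1 + s.re) * (B * (Real.exp ((M + π) * R) * (2 / δ) ^ R)) * 4 := by
        gcongr
    _ = y ^ (1 + s.re) * (4 * B * Real.exp ((M + π) * R) * (2 / δ) ^ R) := by ring


/-! ### Bounds for the remainder pieces of the keyhole contour -/

/-- **The two tails on `σ = a`** (`1 ≤ a ≤ 2`, `T ≥ 1`, `‖z‖ ≤ R`):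
`‖∫_{|t| ≥ T} Ψ(a + it) dt‖ ≤ A′ y^{1+a} T^{−1/2}` for each tail. [cite: MontgomeryVaughan2007, §7.4 p. 177] -/
theorem exists_norm_integral_tails_le (R : ℝ) :
    ∃ A' : ℝ, 0 ≤ A' ∧ ∀ (y : ℝ), 0 < y → ∀ (a T : ℝ), 1 ≤ a → a ≤ 2 → 1 ≤ T → ∀ z : ℂ, ‖z‖ ≤ R →
      ∀ Ψ : ℂ → ℂ, (∀ s, Ψ s = (y : ℂ) ^ (1 + s) *
        (selbergF s z * exp (z * (logZeta₁ s - log (s - 1)))) * kernel s) →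
      ‖∫ t in Ioi T, Ψ ((a : ℂ) + t * I)‖ ≤ A' * y ^ (1 + a) * T ^ (-(1 / 2 : ℝ)) ∧
      ‖∫ t in Iic (-T), Ψ ((a : ℂ) + t * I)‖ ≤ A' * y ^ (1 + a) * T ^ (-(1 / 2 : ℝ)) := by
  obtain ⟨A, hA, hfar⟩ := exists_norm_integrand_le_far R
  obtain ⟨K, hK, hlog⟩ := exists_rpow_log_le R
  refine ⟨2 * A * K, by positivity, fun y hy a T ha1 ha2 hT z hz Ψ hΨ ↦ ?_⟩
  have hT0 : 0 < T := by linarith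
  -- pointwise bound for `|t| ≥ 1`
  have hpt : ∀ t : ℝ, 1 ≤ |t| → ‖Ψ ((a : ℂ) + t * I)‖ ≤ A * K * y ^ (1 + a) * |t| ^ (-(3 / 2 : ℝ)) := by
    intro t ht
    have hs : ((a : ℂ) + t * I) ∈ zfrRegion := mem_zfrRegion_of_one_le_re (by simpa using ha1)
    have h := hfar y hy z _ hz hs (by simp; linarith) (by simpa using ht)
    rw [hΨ]
    refine h.trans ?_
    simp only [add_re, ofReal_re, mul_re, I_re, mul_zero, ofReal_im, I_im, mul_one, sub_self,
      add_zero, add_im, mul_im, zero_add]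
    have ht0 : 0 < |t| := by linarith
    have hl := hlog |t| ht
    have e : |t| ^ (-(3 / 2 : ℝ)) = |t| ^ (1 / 2 : ℝ) / t ^ 2 := by
      rw [← sq_abs t, show (-(3 / 2 : ℝ)) = 1 / 2 - 2 by norm_num, Real.rpow_sub ht0,
        Real.rpow_two]
    rw [e]
    have hy' : 0 ≤ y ^ (1 + a) := Real.rpow_nonneg hy.le _
    calc y ^ (1 + a) * (A * Real.log (|t| + 3) ^ R / t ^ 2)
        ≤ y ^ (1 + a) * (A * (K * |t| ^ (1 / 2 : ℝ)) / t ^ 2) := by gcongr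
      _ = A * K * y ^ (1 + a) * (|t| ^ (1 / 2 : ℝ) / t ^ 2) := by ring
  set g : ℝ → ℝ := fun t ↦ A * K * y ^ (1 + a) * t ^ (-(3 / 2 : ℝ)) with hg
  have hgi : IntegrableOn g (Ioi T) :=
    (integrableOn_Ioi_rpow_of_lt (by norm_num : (-(3 / 2 : ℝ)) < -1) hT0).const_mul _
  have hgint : ∫ t in Ioi T, g t = 2 * A * K * y ^ (1 + a) * T ^ (-(1 / 2 : ℝ)) := by
    rw [hg, MeasureTheory.integral_const_mul, integral_Ioi_rpow_of_lt (by norm_num) hT0]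
    have : (-(3 / 2 : ℝ)) + 1 = -(1 / 2 : ℝ) := by norm_num
    rw [this]; ring
  constructor
  · have hbound : ∀ᵐ t : ℝ ∂(volume.restrict (Ioi T)), ‖Ψ ((a : ℂ) + t * I)‖ ≤ g t := by
      refine (ae_restrict_iff' measurableSet_Ioi).2 (Eventually.of_forall fun t (ht : T < t) ↦ ?_)
      have ht1 : 1 ≤ |t| := by rw [abs_of_pos (hT0.trans ht)]; linarith
      have := hpt t ht1
      rwa [abs_of_pos (hT0.trans ht)] at this
    exact (norm_integral_le_of_norm_le hgi hbound).trans (le_of_eq hgint)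
  · rw [← integral_comp_neg_Ioi]
    have hbound : ∀ᵐ t : ℝ ∂(volume.restrict (Ioi T)), ‖Ψ ((a : ℂ) + ((-t : ℝ) : ℂ) * I)‖ ≤ g t := by
      refine (ae_restrict_iff' measurableSet_Ioi).2 (Eventually.of_forall fun t (ht : T < t) ↦ ?_)
      have ht1 : 1 ≤ |(-t)| := by rw [abs_neg, abs_of_pos (hT0.trans ht)]; linarith
      have := hpt (-t) ht1
      rwa [abs_neg, abs_of_pos (hT0.trans ht)] at this
    exact (norm_integral_le_of_norm_le hgi hbound).trans (le_of_eq hgint)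

/-- **The horizontal sides `t = ±T`** (`3/4 ≤ b ≤ a ≤ 2`, `T ≥ 1`, the side inside the region):
`‖∫_b^a Ψ(x ± iT) dx‖ ≤ A (log(T+3))^R y^{1+a}/T²`. [cite: MontgomeryVaughan2007, §7.4 p. 178] -/
theorem exists_norm_integral_horizontal_le (R : ℝ) :
    ∃ A : ℝ, 0 ≤ A ∧ ∀ (y : ℝ), 1 ≤ y → ∀ (a b T : ℝ), 3 / 4 ≤ b → b ≤ a → a ≤ 2 → 1 ≤ T →
      1 - 4 * zfrConst / Real.log (T + 3) < b → ∀ z : ℂ, ‖z‖ ≤ R →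
      ∀ Ψ : ℂ → ℂ, (∀ s, Ψ s = (y : ℂ) ^ (1 + s) *
        (selbergF s z * exp (z * (logZeta₁ s - log (s - 1)))) * kernel s) →
      ∀ T' : ℝ, (T' = T ∨ T' = -T) →
      ‖∫ x in b..a, Ψ ((x : ℂ) + T' * I)‖ ≤ A * Real.log (T + 3) ^ R * y ^ (1 + a) / T ^ 2 := by
  obtain ⟨A, hA, hfar⟩ := exists_norm_integrand_le_far R
  refine ⟨2 * A, by positivity, fun y hy a b T hb hba ha2 hT hreg z hz Ψ hΨ T' hT' ↦ ?_⟩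
  have hT'abs : |T'| = T := by
    rcases hT' with rfl | rfl
    · exact abs_of_pos (by linarith)
    · rw [abs_neg, abs_of_pos (by linarith)]
  have hpt : ∀ x ∈ Ι b a, ‖Ψ ((x : ℂ) + T' * I)‖ ≤ A * Real.log (T + 3) ^ R * y ^ (1 + a) / T ^ 2 := by
    intro x hx
    rw [uIoc_of_le hba] at hx
    have hs : ((x : ℂ) + T' * I) ∈ zfrRegion :=
      mem_zfrRegion_of_le (T := T) (by simp [hT'abs]) (by simp; linarith [hx.1])
    have h := hfar y (by linarith) z _ hz hs (by simp; linarith [hx.1]) (by simp [hT'abs]; linarith)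
    rw [hΨ]
    refine h.trans ?_
    simp only [add_re, ofReal_re, mul_re, I_re, mul_zero, ofReal_im, I_im, mul_one, sub_self,
      add_zero, add_im, mul_im, zero_add, hT'abs]
    have hT'2 : T' ^ 2 = T ^ 2 := by rcases hT' with rfl | rfl <;> ring
    rw [hT'2]
    have hyx : y ^ (1 + x) ≤ y ^ (1 + a) := Real.rpow_le_rpow_of_exponent_le hy (by linarith [hx.2])
    have hpos : 0 ≤ A * Real.log (T + 3) ^ R / T ^ 2 := by
      have : 0 ≤ Real.log (T + 3) ^ R := Real.rpow_nonneg (Real.log_nonneg (by linarith)) _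
      positivity
    calc y ^ (1 + x) * (A * Real.log (T + 3) ^ R / T ^ 2)
        ≤ y ^ (1 + a) * (A * Real.log (T + 3) ^ R / T ^ 2) := mul_le_mul_of_nonneg_right hyx hpos
      _ = A * Real.log (T + 3) ^ R * y ^ (1 + a) / T ^ 2 := by ring
  have h := intervalIntegral.norm_integral_le_of_norm_le_const hpt
  rw [abs_of_nonneg (by linarith : 0 ≤ a - b)] at h
  have hpos : 0 ≤ A * Real.log (T + 3) ^ R * y ^ (1 + a) / T ^ 2 := by
    have : 0 ≤ Real.log (T + 3) ^ R := Real.rpow_nonneg (Real.log_nonneg (by linarith)) _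
    positivity
  calc ‖∫ x in b..a, Ψ ((x : ℂ) + T' * I)‖ ≤ A * Real.log (T + 3) ^ R * y ^ (1 + a) / T ^ 2 * (a - b) := h
    _ ≤ A * Real.log (T + 3) ^ R * y ^ (1 + a) / T ^ 2 * 2 :=
        mul_le_mul_of_nonneg_left (by linarith) hpos
    _ = 2 * A * Real.log (T + 3) ^ R * y ^ (1 + a) / T ^ 2 := by ring

/-- **The left side `σ = b`, far part `1 ≤ |t| ≤ T`**:
`‖∫_1^T Ψ(b + it) dt‖, ‖∫_{−T}^{−1} Ψ(b + it) dt‖ ≤ A (log(T+3))^R y^{1+b}` (using `∫_1^T dt/t² ≤ 1`).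
[cite: MontgomeryVaughan2007, §7.4 p. 178] -/
theorem exists_norm_integral_left_far_le (R : ℝ) (hR : 0 ≤ R) :
    ∃ A : ℝ, 0 ≤ A ∧ ∀ (y : ℝ), 0 < y → ∀ (b T : ℝ), 3 / 4 ≤ b → b ≤ 2 → 1 ≤ T →
      1 - 4 * zfrConst / Real.log (T + 3) < b → ∀ z : ℂ, ‖z‖ ≤ R →
      ∀ Ψ : ℂ → ℂ, (∀ s, Ψ s = (y : ℂ) ^ (1 + s) *
        (selbergF s z * exp (z * (logZeta₁ s - log (s - 1)))) * kernel s) →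
      ‖∫ t in (1 : ℝ)..T, Ψ ((b : ℂ) + t * I)‖ ≤ A * Real.log (T + 3) ^ R * y ^ (1 + b) ∧
      ‖∫ t in (-T)..(-1 : ℝ), Ψ ((b : ℂ) + t * I)‖ ≤ A * Real.log (T + 3) ^ R * y ^ (1 + b) := by
  obtain ⟨A, hA, hfar⟩ := exists_norm_integrand_le_far R
  refine ⟨A, hA, fun y hy b T hb hb2 hT hreg z hz Ψ hΨ ↦ ?_⟩
  have hlogT : 0 ≤ Real.log (T + 3) ^ R := Real.rpow_nonneg (Real.log_nonneg (by linarith)) _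
  -- pointwise bound for `1 ≤ |t| ≤ T`
  have hpt : ∀ t : ℝ, 1 ≤ |t| → |t| ≤ T →
      ‖Ψ ((b : ℂ) + t * I)‖ ≤ A * Real.log (T + 3) ^ R * y ^ (1 + b) * (t ^ 2)⁻¹ := by
    intro t ht1 htT
    have hs : ((b : ℂ) + t * I) ∈ zfrRegion :=
      mem_zfrRegion_of_le (T := T) (by simpa using htT) (by simpa using hreg)
    have h := hfar y hy z _ hz hs (by simp; linarith) (by simpa using ht1)
    rw [hΨ]
    refine h.trans ?_
    simp only [add_re, ofReal_re, mul_re, I_re, mul_zero, ofReal_im, I_im, mul_one, sub_self,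
      add_zero, add_im, mul_im, zero_add]
    have hlog_le : Real.log (|t| + 3) ^ R ≤ Real.log (T + 3) ^ R :=
      Real.rpow_le_rpow (Real.log_nonneg (by linarith [abs_nonneg t]))
        (Real.log_le_log (by linarith [abs_nonneg t]) (by linarith)) hR
    have hy' : 0 ≤ y ^ (1 + b) := Real.rpow_nonneg hy.le _
    have ht2 : 0 < t ^ 2 := by
      have : t ≠ 0 := fun h ↦ by rw [h, abs_zero] at ht1; linarith
      positivity
    calc y ^ (1 + b) * (A * Real.log (|t| + 3) ^ R / t ^ 2)
        ≤ y ^ (1 + b) * (A * Real.log (T + 3) ^ R / t ^ 2) := by gcongr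
      _ = A * Real.log (T + 3) ^ R * y ^ (1 + b) * (t ^ 2)⁻¹ := by ring
  -- `∫_1^T dt/t² ≤ 1`
  have hinv : ∫ t in (1 : ℝ)..T, (t ^ 2)⁻¹ ≤ 1 := by
    have hT0 : 0 < T := by linarith
    have e : ∫ t in (1 : ℝ)..T, (t ^ 2)⁻¹ = ∫ t in (1 : ℝ)..T, t ^ (-2 : ℝ) := by
      refine intervalIntegral.integral_congr fun t ht ↦ ?_
      rw [uIcc_of_le hT] at ht
      have ht0 : 0 < t := by linarith [ht.1]
      rw [show (-2 : ℝ) = -(2 : ℝ) by ring, Real.rpow_neg ht0.le, Real.rpow_two]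
    have h := integral_rpow (a := (1 : ℝ)) (b := T) (r := -2)
      (Or.inr ⟨by norm_num, by
        rw [uIcc_of_le hT]; intro h0; exact absurd h0.1 (by norm_num)⟩)
    rw [e, h, show (-2 : ℝ) + 1 = -1 by norm_num, Real.rpow_neg_one, Real.one_rpow]
    have : 0 < T⁻¹ := by positivity
    have h2 : (T⁻¹ - 1) / (-1 : ℝ) = 1 - T⁻¹ := by ring
    rw [h2]
    linarith
  have hint_inv : IntervalIntegrable (fun t : ℝ ↦ (t ^ 2)⁻¹) volume 1 T := by
    refine ContinuousOn.intervalIntegrable fun t ht ↦ ?_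
    rw [uIcc_of_le hT] at ht
    have ht0 : (0 : ℝ) < t := by linarith [ht.1]
    have : t ^ 2 ≠ 0 := by positivity
    exact ((continuousAt_id.pow 2).inv₀ this).continuousWithinAt
  constructor
  · have h := intervalIntegral.norm_integral_le_of_norm_le hT
      (f := fun t : ℝ ↦ Ψ ((b : ℂ) + t * I))
      (g := fun t : ℝ ↦ A * Real.log (T + 3) ^ R * y ^ (1 + b) * (t ^ 2)⁻¹)
      (Eventually.of_forall fun t ht ↦ hpt t
        (by rw [abs_of_pos (by linarith [ht.1])]; exact ht.1.le)
        (by rw [abs_of_pos (by linarith [ht.1])]; exact ht.2))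
      (hint_inv.const_mul _)
    refine h.trans ?_
    rw [intervalIntegral.integral_const_mul]
    calc A * Real.log (T + 3) ^ R * y ^ (1 + b) * ∫ t in (1 : ℝ)..T, (t ^ 2)⁻¹
        ≤ A * Real.log (T + 3) ^ R * y ^ (1 + b) * 1 := by gcongr
      _ = _ := mul_one _
  · -- reflect `t ↦ −t`
    have e : ∫ t in (-T)..(-1 : ℝ), Ψ ((b : ℂ) + t * I) =
        ∫ t in (1 : ℝ)..T, Ψ ((b : ℂ) + ((-t : ℝ) : ℂ) * I) := by
      rw [intervalIntegral.integral_comp_neg (fun t : ℝ ↦ Ψ ((b : ℂ) + (t : ℂ) * I))]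
    rw [e]
    have h := intervalIntegral.norm_integral_le_of_norm_le hT
      (f := fun t : ℝ ↦ Ψ ((b : ℂ) + ((-t : ℝ) : ℂ) * I))
      (g := fun t : ℝ ↦ A * Real.log (T + 3) ^ R * y ^ (1 + b) * (t ^ 2)⁻¹)
      (Eventually.of_forall fun t ht ↦ by
        have := hpt (-t) (by rw [abs_neg, abs_of_pos (by linarith [ht.1])]; exact ht.1.le)
          (by rw [abs_neg, abs_of_pos (by linarith [ht.1])]; exact ht.2)
        simpa using this)
      (hint_inv.const_mul _)
    refine h.trans ?_
    rw [intervalIntegral.integral_const_mul]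
    calc A * Real.log (T + 3) ^ R * y ^ (1 + b) * ∫ t in (1 : ℝ)..T, (t ^ 2)⁻¹
        ≤ A * Real.log (T + 3) ^ R * y ^ (1 + b) * 1 := by gcongr
      _ = _ := mul_one _

/-- **The left side `σ = b`, near part `δ ≤ |t| ≤ 1`**:
`‖∫_δ^1 Ψ(b + it) dt‖, ‖∫_{−1}^{−δ} Ψ(b + it) dt‖ ≤ A (2/δ)^R y^{1+b}`. [cite: MontgomeryVaughan2007, §7.4 p. 178] -/
theorem exists_norm_integral_left_near_le (R : ℝ) (hR : 0 ≤ R) :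
    ∃ A : ℝ, 0 ≤ A ∧ ∀ (y : ℝ), 0 < y → ∀ (b δ : ℝ), 3 / 4 ≤ b → 1 - zfrWidth 1 / 2 ≤ b → b ≤ 2 →
      0 < δ → δ ≤ 1 → ∀ z : ℂ, ‖z‖ ≤ R →
      ∀ Ψ : ℂ → ℂ, (∀ s, Ψ s = (y : ℂ) ^ (1 + s) *
        (selbergF s z * exp (z * (logZeta₁ s - log (s - 1)))) * kernel s) →
      ‖∫ t in δ..(1 : ℝ), Ψ ((b : ℂ) + t * I)‖ ≤ A * (2 / δ) ^ R * y ^ (1 + b) ∧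
      ‖∫ t in (-1 : ℝ)..(-δ), Ψ ((b : ℂ) + t * I)‖ ≤ A * (2 / δ) ^ R * y ^ (1 + b) := by
  obtain ⟨A, hA, hnear⟩ := exists_norm_integrand_le_near R hR
  refine ⟨A, hA, fun y hy b δ hb hbw hb2 hδ hδ1 z hz Ψ hΨ ↦ ?_⟩
  have hpt : ∀ t : ℝ, δ ≤ |t| → |t| ≤ 1 → ‖Ψ ((b : ℂ) + t * I)‖ ≤ A * (2 / δ) ^ R * y ^ (1 + b) := by
    intro t ht1 ht2
    set s : ℂ := (b : ℂ) + t * I with hsdef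
    have hsre : s.re = b := by simp [hsdef]
    have hsim : s.im = t := by simp [hsdef]
    have hn1 : δ ≤ ‖s - 1‖ := by
      have := abs_im_le_norm (s - 1)
      rw [sub_im, one_im, sub_zero, hsim] at this
      linarith
    have hn2 : ‖s - 1‖ ≤ 2 := by
      calc ‖s - 1‖ ≤ |(s - 1).re| + |(s - 1).im| := Complex.norm_le_abs_re_add_abs_im _
        _ ≤ 1 + 1 := by
            rw [sub_re, one_re, sub_im, one_im, sub_zero, hsre, hsim]
            refine add_le_add (abs_le.2 ⟨by linarith, by linarith⟩) ht2
        _ = 2 := by norm_num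
    have h := hnear y hy δ hδ hδ1 z s hz (by rw [hsim]; exact ht2) (by rw [hsre]; exact hbw)
      (by rw [hsre]; exact hb2) (by rw [hsre]; linarith) hn1 hn2
    rw [hΨ]
    refine h.trans ?_
    rw [hsre]
    have hy' : 0 ≤ y ^ (1 + b) := Real.rpow_nonneg hy.le _
    nlinarith [Real.rpow_nonneg (by positivity : (0 : ℝ) ≤ 2 / δ) R]
  constructor
  · have h := intervalIntegral.norm_integral_le_of_norm_le_const (a := δ) (b := 1)
      (f := fun t : ℝ ↦ Ψ ((b : ℂ) + t * I)) (C := A * (2 / δ) ^ R * y ^ (1 + b)) (fun t ht ↦ by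
        rw [uIoc_of_le hδ1] at ht
        exact hpt t (by rw [abs_of_pos (by linarith [ht.1])]; exact ht.1.le)
          (by rw [abs_of_pos (by linarith [ht.1])]; exact ht.2))
    refine h.trans ?_
    rw [abs_of_nonneg (by linarith)]
    have hpos : 0 ≤ A * (2 / δ) ^ R * y ^ (1 + b) := by positivity
    nlinarith
  · have h := intervalIntegral.norm_integral_le_of_norm_le_const (a := -1) (b := -δ)
      (f := fun t : ℝ ↦ Ψ ((b : ℂ) + t * I)) (C := A * (2 / δ) ^ R * y ^ (1 + b)) (fun t ht ↦ by
        rw [uIoc_of_le (by linarith)] at ht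
        exact hpt t (by rw [abs_of_neg (by linarith [ht.2])]; linarith [ht.2])
          (by rw [abs_of_neg (by linarith [ht.2])]; linarith [ht.1]))
    refine h.trans ?_
    rw [show |(-δ) - -1| = 1 - δ by rw [abs_of_nonneg (by linarith)]; ring]
    have hpos : 0 ≤ A * (2 / δ) ^ R * y ^ (1 + b) := by positivity
    nlinarith


/-! ### Near the branch point: `Ψ(s) = (s − 1)^{−z} y^{1+s} Q_z(s)` with `Q_z` Lipschitz at `1` -/

/-- **Cauchy–Lipschitz**: a function holomorphic and bounded by `M` on `ball c r` is
`(4M/r)`-Lipschitz at `c` on `‖s − c‖ ≤ r/2`. [folklore] -/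
theorem norm_sub_le_of_bound_on_ball {f : ℂ → ℂ} {c : ℂ} {r M : ℝ} (hr : 0 < r)
    (hf : DifferentiableOn ℂ f (ball c r)) (hM : ∀ w ∈ ball c r, ‖f w‖ ≤ M) {s : ℂ}
    (hs : ‖s - c‖ ≤ r / 2) : ‖f s - f c‖ ≤ 4 * M / r * ‖s - c‖ := by
  have hderiv : ∀ p ∈ closedBall c (r / 2), ‖deriv f p‖ ≤ 4 * M / r := by
    intro p hp
    have hp' : ‖p - c‖ ≤ r / 2 := by simpa [dist_eq_norm] using hp
    have hsub : closedBall p (r / 4) ⊆ ball c r := by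
      intro w hw
      have hw' : ‖w - p‖ ≤ r / 4 := by simpa [dist_eq_norm] using hw
      rw [mem_ball, dist_eq_norm]
      calc ‖w - c‖ = ‖(w - p) + (p - c)‖ := by ring_nf
        _ ≤ ‖w - p‖ + ‖p - c‖ := norm_add_le _ _
        _ < r := by linarith
    have h := norm_deriv_le_of_forall_mem_sphere_norm_le (by positivity : 0 < r / 4)
      (hf.diffContOnCl_ball hsub) (fun w hw ↦ hM w (hsub (sphere_subset_closedBall hw)))
    calc ‖deriv f p‖ ≤ M / (r / 4) := h
      _ = 4 * M / r := by field_simp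
  have hdiffAt : ∀ p ∈ closedBall c (r / 2), DifferentiableAt ℂ f p := fun p hp ↦
    hf.differentiableAt (isOpen_ball.mem_nhds (by
      have hp' : ‖p - c‖ ≤ r / 2 := by simpa [dist_eq_norm] using hp
      rw [mem_ball, dist_eq_norm]; linarith))
  exact (convex_closedBall c (r / 2)).norm_image_sub_le_of_norm_deriv_le hdiffAt hderiv
    (mem_closedBall_self (by positivity)) (by simpa [dist_eq_norm] using hs)

/-- A disc around `s = 1` inside the region: radius `ρ₁ = min(1/4, zfrWidth 1/2)`. [folklore] -/
theorem ball_one_subset_zfrRegion :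
    ball (1 : ℂ) (min (1 / 4) (zfrWidth 1 / 2)) ⊆ zfrRegion := by
  intro w hw
  rw [mem_ball, dist_eq_norm] at hw
  have h1 : ‖w - 1‖ < 1 / 4 := lt_of_lt_of_le hw (min_le_left _ _)
  have h2 : ‖w - 1‖ < zfrWidth 1 / 2 := lt_of_lt_of_le hw (min_le_right _ _)
  have him : |w.im| ≤ 1 := by
    have := abs_im_le_norm (w - 1)
    simp at this; linarith
  have hre : 1 - zfrWidth 1 / 2 < w.re := by
    have := abs_re_le_norm (w - 1)
    simp only [sub_re, one_re] at this
    rw [abs_le] at this; linarith [this.1]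
  have hw1 : zfrWidth 1 ≤ zfrWidth w.im := zfrWidth_anti (by rwa [abs_one])
  show 1 - zfrWidth w.im < w.re
  linarith [zfrWidth_pos 1]

/-- **The smooth factor `G_z(s) = exp(z logZeta₁ s)/(s(s+1))` is bounded and Lipschitz at `1`**,
uniformly in `‖z‖ ≤ R`: with `ρ₁ = min(1/4, zfrWidth 1/2)` there is `A` with `‖G_z(w)‖ ≤ A` on
`ball 1 ρ₁` and `‖G_z(s) − G_z(1)‖ ≤ (4A/ρ₁) ‖s − 1‖` for `‖s − 1‖ ≤ ρ₁/2`. [folklore] -/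
theorem exists_bound_lipschitz_G (R : ℝ) (hR : 0 ≤ R) :
    ∃ A : ℝ, 0 ≤ A ∧ ∀ z : ℂ, ‖z‖ ≤ R →
      (∀ w ∈ ball (1 : ℂ) (min (1 / 4) (zfrWidth 1 / 2)), ‖exp (z * logZeta₁ w) * kernel w‖ ≤ A) ∧
      (∀ s : ℂ, ‖s - 1‖ ≤ min (1 / 4) (zfrWidth 1 / 2) / 2 →
        ‖exp (z * logZeta₁ s) * kernel s - exp (z * logZeta₁ 1) * kernel 1‖ ≤
          4 * A / min (1 / 4) (zfrWidth 1 / 2) * ‖s - 1‖) := by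
  obtain ⟨M, hM, hlog⟩ := exists_norm_logZeta₁_le_near_one
  set ρ₁ : ℝ := min (1 / 4) (zfrWidth 1 / 2) with hρ₁
  have hρ₁pos : 0 < ρ₁ := lt_min (by norm_num) (by linarith [zfrWidth_pos 1])
  refine ⟨Real.exp (R * M) * 4, by positivity, fun z hz ↦ ?_⟩
  have hbound : ∀ w ∈ ball (1 : ℂ) ρ₁, ‖exp (z * logZeta₁ w) * kernel w‖ ≤ Real.exp (R * M) * 4 := by
    intro w hw
    have hw' := hw
    rw [mem_ball, dist_eq_norm] at hw'
    have h1 : ‖w - 1‖ < 1 / 4 := lt_of_lt_of_le hw' (min_le_left _ _)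
    have h2 : ‖w - 1‖ < zfrWidth 1 / 2 := lt_of_lt_of_le hw' (min_le_right _ _)
    have him : |w.im| ≤ 1 := by
      have := abs_im_le_norm (w - 1); simp at this; linarith
    have hre : |w.re - 1| ≤ 1 / 4 := by
      have := abs_re_le_norm (w - 1); simp only [sub_re, one_re] at this; linarith
    have hre2 : |w.re - 1| < zfrWidth 1 / 2 := by
      have := abs_re_le_norm (w - 1); simp only [sub_re, one_re] at this; linarith
    rw [abs_le] at hre
    rw [abs_lt] at hre2
    have hL : ‖logZeta₁ w‖ ≤ M := hlog w him (by linarith [hre2.1]) (by linarith [hre.2])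
    have hE : ‖exp (z * logZeta₁ w)‖ ≤ Real.exp (R * M) := by
      refine (norm_exp_mul_le _ _).trans ?_
      rw [Real.exp_le_exp]
      exact mul_le_mul hz hL (norm_nonneg _) hR
    have hK : ‖kernel w‖ ≤ 4 := by
      have h := ClassicalPsiData.norm_kernel_le_four_div (σ := w.re) (by linarith [hre.1]) w.im
      rw [show ((w.re : ℂ) + (w.im : ℂ) * I) = w from Complex.ext (by simp) (by simp)] at h
      refine h.trans ?_
      rw [mul_inv_le_iff₀ (by positivity)]
      nlinarith [sq_nonneg w.im]
    rw [norm_mul]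
    exact mul_le_mul hE hK (norm_nonneg _) (Real.exp_pos _).le
  refine ⟨hbound, fun s hs ↦ ?_⟩
  have hdiff : DifferentiableOn ℂ (fun w ↦ exp (z * logZeta₁ w) * kernel w) (ball (1 : ℂ) ρ₁) := by
    intro w hw
    have hwΩ : w ∈ zfrRegion := ball_one_subset_zfrRegion hw
    have hw' := hw
    rw [mem_ball, dist_eq_norm] at hw'
    have hre : |w.re - 1| ≤ 1 / 4 := by
      have := abs_re_le_norm (w - 1); simp only [sub_re, one_re] at this
      linarith [lt_of_lt_of_le hw' (min_le_left _ _)]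
    rw [abs_le] at hre
    have hL : DifferentiableAt ℂ logZeta₁ w :=
      differentiableOn_logZeta₁.differentiableAt (isOpen_zfrRegion.mem_nhds hwΩ)
    have hw0 : w ≠ 0 := fun h ↦ by rw [h] at hre; simp at hre; linarith [hre.1]
    have hw1 : w + 1 ≠ 0 := fun h ↦ by
      have := congrArg Complex.re h; simp at this; linarith [hre.1]
    have hk : DifferentiableAt ℂ kernel w := by
      unfold ClassicalPsiData.kernel
      exact (differentiableAt_const _).div (differentiableAt_id.mul (differentiableAt_id.add_const 1))
        (mul_ne_zero hw0 hw1)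
    exact (((hL.const_mul z).cexp).mul hk).differentiableWithinAt
  exact norm_sub_le_of_bound_on_ball hρ₁pos hdiff hbound hs

/-- **`Q_z(s) = F(s, z) exp(z logZeta₁ s)/(s(s+1))` is Lipschitz at `s = 1`, uniformly in `‖z‖ ≤ R`**:
there are `ρ > 0` and `M_Q` with `‖Q_z(s) − Q_z(1)‖ ≤ M_Q ‖s − 1‖` for `‖s − 1‖ ≤ ρ`, and
`Q_z(1) = F(1, z)/2`. This is MV's "`ζ(s)^z F(s,z)/s = (s−1)^{−z}(… + O(|s − 1|))` on `𝒞₂`".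
[cite: MontgomeryVaughan2007, §7.4 p. 178] -/
theorem exists_lipschitz_Q (R : ℝ) (hR : 0 ≤ R) :
    ∃ ρ : ℝ, 0 < ρ ∧ ρ ≤ 1 / 8 ∧ ∃ MQ : ℝ, 0 ≤ MQ ∧ ∀ z : ℂ, ‖z‖ ≤ R → ∀ s : ℂ, ‖s - 1‖ ≤ ρ →
      ‖selbergF s z * (exp (z * logZeta₁ s) * kernel s) - selbergF 1 z / 2‖ ≤ MQ * ‖s - 1‖ := by
  obtain ⟨B', hB', hlipF⟩ := exists_lipschitz_selbergF R
  obtain ⟨B, hB, hF⟩ := exists_bound_selbergF (by norm_num : (1 : ℝ) / 2 < 3 / 4) R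
  obtain ⟨A, hA, hG⟩ := exists_bound_lipschitz_G R hR
  set ρ₁ : ℝ := min (1 / 4) (zfrWidth 1 / 2) with hρ₁
  have hρ₁pos : 0 < ρ₁ := lt_min (by norm_num) (by linarith [zfrWidth_pos 1])
  have hρ₁le : ρ₁ ≤ 1 / 4 := min_le_left _ _
  refine ⟨min (1 / 8) (ρ₁ / 2), lt_min (by norm_num) (by positivity), min_le_left _ _,
    B' * A + B * (4 * A / ρ₁), by positivity, fun z hz s hs ↦ ?_⟩
  have hs8 : ‖s - 1‖ ≤ 1 / 8 := hs.trans (min_le_left _ _)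
  have hsρ : ‖s - 1‖ ≤ ρ₁ / 2 := hs.trans (min_le_right _ _)
  obtain ⟨hGb, hGl⟩ := hG z hz
  have hsball : s ∈ ball (1 : ℂ) ρ₁ := by
    rw [mem_ball, dist_eq_norm]; linarith
  -- `Q_z(1) = F(1,z)/2`
  have hG1 : exp (z * logZeta₁ 1) * kernel 1 = 1 / 2 := by
    rw [logZeta₁_one, mul_zero, exp_zero, one_mul, ClassicalPsiData.kernel]; norm_num
  have hQ1 : selbergF 1 z / 2 = selbergF 1 z * (exp (z * logZeta₁ 1) * kernel 1) := by
    rw [hG1]; ring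
  rw [hQ1]
  have hsre : 3 / 4 ≤ s.re := by
    have := abs_re_le_norm (s - 1); simp only [sub_re, one_re] at this
    rw [abs_le] at this; linarith [this.1]
  have h1 : ‖selbergF s z - selbergF 1 z‖ ≤ B' * ‖s - 1‖ := hlipF s z hs8 hz
  have h2 : ‖exp (z * logZeta₁ s) * kernel s‖ ≤ A := hGb s hsball
  have h3 : ‖selbergF 1 z‖ ≤ B := hF 1 z (by norm_num) hz
  have h4 := hGl s hsρ
  calc ‖selbergF s z * (exp (z * logZeta₁ s) * kernel s) -
        selbergF 1 z * (exp (z * logZeta₁ 1) * kernel 1)‖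
      = ‖(selbergF s z - selbergF 1 z) * (exp (z * logZeta₁ s) * kernel s) +
          selbergF 1 z * (exp (z * logZeta₁ s) * kernel s - exp (z * logZeta₁ 1) * kernel 1)‖ := by
        ring_nf
    _ ≤ ‖selbergF s z - selbergF 1 z‖ * ‖exp (z * logZeta₁ s) * kernel s‖ +
          ‖selbergF 1 z‖ * ‖exp (z * logZeta₁ s) * kernel s - exp (z * logZeta₁ 1) * kernel 1‖ :=
        (norm_add_le _ _).trans (add_le_add (norm_mul_le _ _) (norm_mul_le _ _))
    _ ≤ B' * ‖s - 1‖ * A + B * (4 * A / ρ₁ * ‖s - 1‖) := by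
        gcongr
    _ = (B' * A + B * (4 * A / ρ₁)) * ‖s - 1‖ := by ring

/-- **`ζ(s)^z = exp(z logZeta₁ s) · (s − 1)^{−z}`** off the branch point: the factorisation of the
power used on the keyhole. [folklore] -/
theorem zetaPow_eq_mul_cpow (z : ℂ) {s : ℂ} (hs : s ≠ 1) :
    exp (z * (logZeta₁ s - log (s - 1))) = exp (z * logZeta₁ s) * (s - 1) ^ (-z) := by
  rw [cpow_def_of_ne_zero (sub_ne_zero.2 hs), mul_sub, sub_eq_add_neg, Complex.exp_add]
  congr 1
  congr 1
  ring

/-- The integrand near the branch point: `Ψ(s) = (s − 1)^{−z} · y^{1+s} · Q_z(s)`. [folklore] -/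
theorem integrand_eq_cpow_mul (y : ℝ) (z : ℂ) {s : ℂ} (hs : s ≠ 1) :
    (y : ℂ) ^ (1 + s) * (selbergF s z * exp (z * (logZeta₁ s - log (s - 1)))) * kernel s =
      (s - 1) ^ (-z) * ((y : ℂ) ^ (1 + s) * (selbergF s z * (exp (z * logZeta₁ s) * kernel s))) := by
  rw [zetaPow_eq_mul_cpow z hs]; ring

/-! ### The three sides of the keyhole, main parts: substitution `s = 1 + w/log y` -/

/-- `(w/L)^{−z} = L^{z} exp(−z Log w)` for `L > 0`, `w ≠ 0`. [folklore] -/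
theorem div_ofReal_cpow_neg {L : ℝ} (hL : 0 < L) {w : ℂ} (hw : w ≠ 0) (z : ℂ) :
    (w / L) ^ (-z) = (L : ℂ) ^ z * exp (-(z * log w)) := by
  have hL0 : (L : ℂ) ≠ 0 := ofReal_ne_zero.2 hL.ne'
  have hwL : w / L ≠ 0 := div_ne_zero hw hL0
  have e : w / (L : ℂ) = ((L⁻¹ : ℝ) : ℂ) * w := by rw [ofReal_inv]; field_simp
  rw [cpow_def_of_ne_zero hwL, e, log_ofReal_mul (inv_pos.2 hL) hw, Real.log_inv, ofReal_neg,
    cpow_def_of_ne_zero hL0, ← ofReal_log hL.le, ← Complex.exp_add]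
  congr 1; ring

/-- `L^{z−1} = L^{z}/L`. [folklore] -/
theorem ofReal_cpow_sub_one {L : ℝ} (hL : 0 < L) (z : ℂ) :
    (L : ℂ) ^ (z - 1) = (L : ℂ) ^ z * (L : ℂ)⁻¹ := by
  rw [cpow_sub _ _ (ofReal_ne_zero.2 hL.ne'), cpow_one, div_eq_mul_inv]

/-- **Lower / upper side of the keyhole, main part**: with `L = log y`, `a = 1 + 1/L`, `δ = 1/L`,
`β = L(1 − b)` and `ε = ∓1`,
`∫_b^a (s−1)^{−z} y^{1+s} dx |_{s = x + iεδ} = y² L^{z−1} ∫_{−β}^{1} e^{u+iε} (u + iε)^{−z} du`.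
[cite: MontgomeryVaughan2007, §7.4 p. 178 ("by the change of variables s = 1 + w/log x")] -/
theorem integral_horizontal_edge_main {L : ℝ} (hL : 0 < L) (b : ℝ) (z : ℂ) (ε : ℝ) (hε : ε ≠ 0) :
    ∫ x in b..(1 + 1 / L), ((x : ℂ) + (ε / L : ℝ) * I - 1) ^ (-z) *
        ((Real.exp L : ℝ) : ℂ) ^ (1 + ((x : ℂ) + (ε / L : ℝ) * I)) =
      ((Real.exp L : ℝ) : ℂ) ^ 2 * (L : ℂ) ^ (z - 1) *
        ∫ u in (-(L * (1 - b)))..1, exp (((u : ℂ) + ε * I) - z * log ((u : ℂ) + ε * I)) := by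
  have hL0 : L ≠ 0 := hL.ne'
  have hLC : (L : ℂ) ≠ 0 := ofReal_ne_zero.2 hL0
  have exp_ofReal_cpow : ∀ w : ℂ, ((Real.exp L : ℝ) : ℂ) ^ w = exp (L * w) := fun w ↦ by
    rw [ofReal_exp, cpow_def_of_ne_zero (exp_ne_zero _),
      log_exp (by simp; linarith [Real.pi_pos]) (by simp; linarith [Real.pi_pos])]
  set g : ℝ → ℂ := fun u ↦ ((Real.exp L : ℝ) : ℂ) ^ 2 * (L : ℂ) ^ z *
    exp (((u : ℂ) + ε * I) - z * log ((u : ℂ) + ε * I)) with hg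
  -- pointwise: the integrand at `x` is `g (L x − L)`
  have hpt : ∀ x : ℝ, ((x : ℂ) + (ε / L : ℝ) * I - 1) ^ (-z) *
      ((Real.exp L : ℝ) : ℂ) ^ (1 + ((x : ℂ) + (ε / L : ℝ) * I)) = g (L * x + -L) := by
    intro x
    set w : ℂ := ((L * x + -L : ℝ) : ℂ) + ε * I with hw
    have hw0 : w ≠ 0 := fun h ↦ by
      have := congrArg Complex.im h; simp [hw] at this; exact hε this
    have e1 : (x : ℂ) + (ε / L : ℝ) * I - 1 = w / L := by
      rw [hw]; push_cast; field_simp; ring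
    have e2 : ((Real.exp L : ℝ) : ℂ) ^ (1 + ((x : ℂ) + (ε / L : ℝ) * I)) =
        ((Real.exp L : ℝ) : ℂ) ^ 2 * exp w := by
      rw [exp_ofReal_cpow, show (((Real.exp L : ℝ) : ℂ)) ^ 2 = ((Real.exp L : ℝ) : ℂ) ^ ((2 : ℕ) : ℂ)
        from (cpow_natCast _ 2).symm, exp_ofReal_cpow, ← Complex.exp_add, hw]
      congr 1
      push_cast; field_simp; ring
    rw [e1, e2, div_ofReal_cpow_neg hL hw0, hg]
    simp only
    rw [show exp (((L * x + -L : ℝ) : ℂ) + ε * I - z * log (((L * x + -L : ℝ) : ℂ) + ε * I)) =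
      exp w * exp (-(z * log w)) by rw [← Complex.exp_add, hw]; ring_nf]
    ring
  simp_rw [hpt]
  rw [intervalIntegral.integral_comp_mul_add (fun u ↦ g u) hL0, hg]
  simp only
  rw [intervalIntegral.integral_const_mul, show L * (1 + 1 / L) + -L = 1 by field_simp; ring,
    show L * b + -L = -(L * (1 - b)) by ring, ofReal_cpow_sub_one hL, real_smul, ofReal_inv]
  ring

/-- **Right side of the keyhole, main part**: with `L = log y`, `a = 1 + 1/L`, `δ = 1/L`,
`∫_{−δ}^{δ} (s−1)^{−z} y^{1+s} dt |_{s = a + it} = y² L^{z−1} ∫_{−1}^{1} e^{1+iv} (1 + iv)^{−z} dv`.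
[cite: MontgomeryVaughan2007, §7.4 p. 178] -/
theorem integral_right_edge_main {L : ℝ} (hL : 0 < L) (z : ℂ) :
    ∫ t in (-(1 / L))..(1 / L), ((((1 + 1 / L : ℝ)) : ℂ) + (t : ℂ) * I - 1) ^ (-z) *
        ((Real.exp L : ℝ) : ℂ) ^ (1 + ((((1 + 1 / L : ℝ)) : ℂ) + (t : ℂ) * I)) =
      ((Real.exp L : ℝ) : ℂ) ^ 2 * (L : ℂ) ^ (z - 1) *
        ∫ v in (-1 : ℝ)..1, exp (((1 : ℂ) + (v : ℂ) * I) - z * log ((1 : ℂ) + (v : ℂ) * I)) := by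
  have hL0 : L ≠ 0 := hL.ne'
  have hLC : (L : ℂ) ≠ 0 := ofReal_ne_zero.2 hL0
  have exp_ofReal_cpow : ∀ w : ℂ, ((Real.exp L : ℝ) : ℂ) ^ w = exp (L * w) := fun w ↦ by
    rw [ofReal_exp, cpow_def_of_ne_zero (exp_ne_zero _),
      log_exp (by simp; linarith [Real.pi_pos]) (by simp; linarith [Real.pi_pos])]
  set g : ℝ → ℂ := fun v ↦ ((Real.exp L : ℝ) : ℂ) ^ 2 * (L : ℂ) ^ z *
    exp (((1 : ℂ) + (v : ℂ) * I) - z * log ((1 : ℂ) + (v : ℂ) * I)) with hg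
  have hpt : ∀ t : ℝ, ((((1 + 1 / L : ℝ)) : ℂ) + (t : ℂ) * I - 1) ^ (-z) *
      ((Real.exp L : ℝ) : ℂ) ^ (1 + ((((1 + 1 / L : ℝ)) : ℂ) + (t : ℂ) * I)) = g (L * t) := by
    intro t
    set w : ℂ := (1 : ℂ) + ((L * t : ℝ) : ℂ) * I with hw
    have hw0 : w ≠ 0 := fun h ↦ by
      have := congrArg Complex.re h; simp [hw] at this
    have e1 : (((1 + 1 / L : ℝ)) : ℂ) + (t : ℂ) * I - 1 = w / L := by
      rw [hw]; push_cast; field_simp; ring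
    have e2 : ((Real.exp L : ℝ) : ℂ) ^ (1 + ((((1 + 1 / L : ℝ)) : ℂ) + (t : ℂ) * I)) =
        ((Real.exp L : ℝ) : ℂ) ^ 2 * exp w := by
      rw [exp_ofReal_cpow, show (((Real.exp L : ℝ) : ℂ)) ^ 2 = ((Real.exp L : ℝ) : ℂ) ^ ((2 : ℕ) : ℂ)
        from (cpow_natCast _ 2).symm, exp_ofReal_cpow, ← Complex.exp_add, hw]
      congr 1
      push_cast; field_simp; ring
    rw [e1, e2, div_ofReal_cpow_neg hL hw0, hg]
    simp only
    rw [show exp ((1 : ℂ) + ((L * t : ℝ) : ℂ) * I - z * log ((1 : ℂ) + ((L * t : ℝ) : ℂ) * I)) =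
      exp w * exp (-(z * log w)) by rw [← Complex.exp_add, hw]; ring_nf]
    ring
  simp_rw [hpt]
  rw [intervalIntegral.integral_comp_mul_left (fun v ↦ g v) hL0, hg]
  simp only
  rw [intervalIntegral.integral_const_mul, show L * (-(1 / L)) = -1 by field_simp,
    show L * (1 / L) = 1 by field_simp, ofReal_cpow_sub_one hL, real_smul, ofReal_inv]
  ring


/-! ### The three sides of the keyhole, error parts -/

/-- `‖w^{−z}‖ ≤ ‖w‖^{−Re z} e^{π‖z‖}` for `w ≠ 0`. [folklore] -/
theorem norm_cpow_neg_le {w : ℂ} (hw : w ≠ 0) (z : ℂ) :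
    ‖w ^ (-z)‖ ≤ ‖w‖ ^ (-z.re) * Real.exp (π * ‖z‖) := by
  rw [norm_cpow_of_ne_zero hw, neg_re, neg_im, div_eq_mul_inv, ← Real.exp_neg]
  refine mul_le_mul_of_nonneg_left ?_ (Real.rpow_nonneg (norm_nonneg w) _)
  rw [Real.exp_le_exp]
  have h1 : |arg w| ≤ π := abs_arg_le_pi w
  have h2 : |z.im| ≤ ‖z‖ := abs_im_le_norm z
  have : -(arg w * -z.im) = arg w * z.im := by ring
  rw [this]
  calc arg w * z.im ≤ |arg w * z.im| := le_abs_self _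
    _ = |arg w| * |z.im| := abs_mul _ _
    _ ≤ π * ‖z‖ := mul_le_mul h1 h2 (abs_nonneg _) Real.pi_pos.le

/-- The weight `φ_R(u) = e^{u} (u² + 1)^{(1+R)/2}` has `∫_c^1 φ_R ≤ K_R` for every `c ≤ 1`
(`φ_R(u) ≤ (2m)! 4^m e^{3/2} e^{u/2}` for `u ≤ 1`, `m = ⌈(1+R)/2⌉`). [cite: MontgomeryVaughan2007, §7.4 p. 178
("∫₀^∞ (u²+1)^{(R−1)/2} e^{−u} du ≪_R 1")] -/
theorem exists_integral_weight_le (R : ℝ) :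
    ∃ K : ℝ, 0 < K ∧ ∀ c : ℝ, c ≤ 1 →
      ∫ u in c..1, Real.exp u * (u ^ 2 + 1) ^ ((1 + R) / 2) ≤ K := by
  set m : ℕ := ⌈(1 + R) / 2⌉₊ with hm
  have hRm : (1 + R) / 2 ≤ m := Nat.le_ceil _
  set C : ℝ := (2 * m).factorial * 2 ^ (2 * m) * Real.exp (3 / 2) with hC
  have hC0 : 0 < C := by positivity
  refine ⟨C * (2 * Real.exp (1 / 2)), by positivity, fun c hc ↦ ?_⟩
  -- pointwise bound for `u ≤ 1`
  have hpt : ∀ u : ℝ, u ≤ 1 → Real.exp u * (u ^ 2 + 1) ^ ((1 + R) / 2) ≤ C * Real.exp (u / 2) := by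
    intro u hu
    have hb : (1 : ℝ) ≤ u ^ 2 + 1 := by nlinarith
    have h1 : (u ^ 2 + 1) ^ ((1 + R) / 2) ≤ (u ^ 2 + 1) ^ (m : ℝ) :=
      Real.rpow_le_rpow_of_exponent_le hb hRm
    rw [Real.rpow_natCast] at h1
    have h2 : (u ^ 2 + 1) ^ m ≤ (|u| + 1) ^ (2 * m) := by
      rw [pow_mul]
      exact pow_le_pow_left₀ (by positivity) (by nlinarith [abs_nonneg u, sq_abs u]) m
    have h3 : (|u| + 1) ^ (2 * m) ≤ (2 * m).factorial * 2 ^ (2 * m) * Real.exp ((|u| + 1) / 2) :=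
      Literature.Analysis.Complex.Hankel.pow_le_factorial_mul_exp_half (by positivity) (2 * m)
    have h4 : Real.exp u * Real.exp ((|u| + 1) / 2) ≤ Real.exp (3 / 2) * Real.exp (u / 2) := by
      rw [← Real.exp_add, ← Real.exp_add, Real.exp_le_exp]
      rcases le_or_gt 0 u with h | h
      · rw [abs_of_nonneg h]; linarith
      · rw [abs_of_neg h]; linarith
    calc Real.exp u * (u ^ 2 + 1) ^ ((1 + R) / 2) ≤ Real.exp u * ((2 * m).factorial * 2 ^ (2 * m) *
          Real.exp ((|u| + 1) / 2)) := by
          exact mul_le_mul_of_nonneg_left (h1.trans (h2.trans h3)) (Real.exp_pos _).le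
      _ = (2 * m).factorial * 2 ^ (2 * m) * (Real.exp u * Real.exp ((|u| + 1) / 2)) := by ring
      _ ≤ (2 * m).factorial * 2 ^ (2 * m) * (Real.exp (3 / 2) * Real.exp (u / 2)) := by
          gcongr
      _ = C * Real.exp (u / 2) := by rw [hC]; ring
  have hcont : Continuous fun u : ℝ ↦ Real.exp u * (u ^ 2 + 1) ^ ((1 + R) / 2) :=
    Real.continuous_exp.mul (Continuous.rpow_const (by fun_prop) fun u ↦ Or.inl (by positivity))
  calc ∫ u in c..1, Real.exp u * (u ^ 2 + 1) ^ ((1 + R) / 2)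
      ≤ ∫ u in c..1, C * Real.exp (u / 2) := by
        refine intervalIntegral.integral_mono_on hc (hcont.intervalIntegrable _ _)
          ((Real.continuous_exp.comp (continuous_id.div_const _)).intervalIntegrable _ _ |>.const_mul C)
          fun u hu ↦ hpt u hu.2
    _ = C * (2 * (Real.exp (1 / 2) - Real.exp (c / 2))) := by
        rw [intervalIntegral.integral_const_mul, intervalIntegral.integral_comp_div _ (two_ne_zero),
          integral_exp, smul_eq_mul]
    _ ≤ C * (2 * Real.exp (1 / 2)) := by
        gcongr
        linarith [Real.exp_pos (c / 2)]

/-- Norm bookkeeping on the horizontal sides: for `w = u + iε` (`|ε| = 1`), `L ≥ 1`, `‖z‖ ≤ R`: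
`‖(w/L)^{−z}‖ · ‖w/L‖ ≤ e^{π R} (u² + 1)^{(1+R)/2} L^{Re z − 1}`. [folklore] -/
theorem norm_cpow_mul_norm_le {u ε L R : ℝ} (hε : ε = 1 ∨ ε = -1) (hL : 1 ≤ L) {z : ℂ}
    (hz : ‖z‖ ≤ R) :
    ‖(((u : ℂ) + ε * I) / L) ^ (-z)‖ * ‖((u : ℂ) + ε * I) / L‖ ≤
      Real.exp (π * R) * (u ^ 2 + 1) ^ ((1 + R) / 2) * L ^ (z.re - 1) := by
  have hL0 : 0 < L := by linarith
  set w : ℂ := (u : ℂ) + ε * I with hw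
  have hε2 : ε ^ 2 = 1 := by rcases hε with rfl | rfl <;> norm_num
  have hwn : ‖w‖ = Real.sqrt (u ^ 2 + 1) := by
    rw [hw, Complex.norm_def]
    congr 1
    simp [Complex.normSq]
    nlinarith
  have hw1 : 1 ≤ ‖w‖ := by
    rw [hwn, Real.le_sqrt (by norm_num) (by positivity)]; nlinarith
  have hw0 : w ≠ 0 := fun h ↦ by rw [h, norm_zero] at hw1; linarith
  have hwL0 : w / L ≠ 0 := div_ne_zero hw0 (ofReal_ne_zero.2 hL0.ne')
  have hnorm : ‖w / L‖ = ‖w‖ / L := by rw [norm_div, Complex.norm_real, Real.norm_of_nonneg hL0.le]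
  have hre : -z.re ≤ R := by linarith [neg_le_abs z.re, abs_re_le_norm z]
  calc ‖(w / L) ^ (-z)‖ * ‖w / L‖
      ≤ (‖w / L‖ ^ (-z.re) * Real.exp (π * ‖z‖)) * ‖w / L‖ :=
        mul_le_mul_of_nonneg_right (norm_cpow_neg_le hwL0 z) (norm_nonneg _)
    _ = Real.exp (π * ‖z‖) * ‖w / L‖ ^ (1 - z.re) := by
        rw [show (1 - z.re) = -z.re + 1 by ring, Real.rpow_add (norm_pos_iff.2 hwL0), Real.rpow_one]
        ring
    _ = Real.exp (π * ‖z‖) * (‖w‖ ^ (1 - z.re) * L ^ (z.re - 1)) := by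
        rw [hnorm, Real.div_rpow (norm_nonneg _) hL0.le, show z.re - 1 = -(1 - z.re) by ring,
          Real.rpow_neg hL0.le, div_eq_mul_inv]
    _ ≤ Real.exp (π * R) * ((u ^ 2 + 1) ^ ((1 + R) / 2) * L ^ (z.re - 1)) := by
        have h1 : Real.exp (π * ‖z‖) ≤ Real.exp (π * R) :=
          Real.exp_le_exp.2 (mul_le_mul_of_nonneg_left hz Real.pi_pos.le)
        have h2 : ‖w‖ ^ (1 - z.re) ≤ (u ^ 2 + 1) ^ ((1 + R) / 2) := by
          calc ‖w‖ ^ (1 - z.re) ≤ ‖w‖ ^ (1 + R) := Real.rpow_le_rpow_of_exponent_le hw1 (by linarith)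
            _ = (u ^ 2 + 1) ^ ((1 + R) / 2) := by
                rw [hwn, Real.sqrt_eq_rpow, ← Real.rpow_mul (by positivity)]
                congr 1; ring
        have h3 : 0 ≤ L ^ (z.re - 1) := Real.rpow_nonneg hL0.le _
        have h4 : 0 ≤ ‖w‖ ^ (1 - z.re) := Real.rpow_nonneg (norm_nonneg _) _
        exact mul_le_mul h1 (mul_le_mul_of_nonneg_right h2 h3) (by positivity) (Real.exp_pos _).le
    _ = _ := by ring

/-- **Horizontal sides of the keyhole, error part**: if `‖f(x)‖ ≤ ‖(s−1)^{−z}‖ y^{1+x} · M_Q ‖s − 1‖`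
at `s = x + iε/L` (`ε = ±1`) for `x ∈ [b, 1 + 1/L]`, then `‖∫_b^{1+1/L} f‖ ≤ K M_Q y² L^{Re z − 2}`
(`y = e^{L}`). [cite: MontgomeryVaughan2007, §7.4 p. 178 ("the linear portions of 𝒞₂ contribute …")] -/
theorem exists_norm_integral_horizontal_edge_error (R : ℝ) :
    ∃ K : ℝ, 0 ≤ K ∧ ∀ (L : ℝ), 1 ≤ L → ∀ b : ℝ, b ≤ 1 + 1 / L → ∀ z : ℂ, ‖z‖ ≤ R →
      ∀ ε : ℝ, (ε = 1 ∨ ε = -1) → ∀ MQ : ℝ, 0 ≤ MQ → ∀ f : ℝ → ℂ,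
      (∀ x ∈ Ι b (1 + 1 / L), ‖f x‖ ≤ ‖((x : ℂ) + (ε / L : ℝ) * I - 1) ^ (-z)‖ *
        Real.exp L ^ (1 + x) * (MQ * ‖(x : ℂ) + (ε / L : ℝ) * I - 1‖)) →
      ‖∫ x in b..(1 + 1 / L), f x‖ ≤ K * MQ * Real.exp L ^ 2 * L ^ (z.re - 2) := by
  obtain ⟨K, hK, hweight⟩ := exists_integral_weight_le R
  refine ⟨Real.exp (π * R) * K, by positivity, fun L hL b hb z hz ε hε MQ hMQ f hf ↦ ?_⟩
  have hL0 : 0 < L := by linarith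
  set a : ℝ := 1 + 1 / L with ha
  set y : ℝ := Real.exp L with hy
  have hy0 : 0 < y := Real.exp_pos L
  -- the bound function
  set g : ℝ → ℝ := fun x ↦ Real.exp (π * R) * MQ * y ^ 2 * L ^ (z.re - 1) *
    (Real.exp (L * x + -L) * ((L * x + -L) ^ 2 + 1) ^ ((1 + R) / 2)) with hg
  have hpt : ∀ x ∈ Ι b a, ‖f x‖ ≤ g x := by
    intro x hx
    refine (hf x hx).trans ?_
    set u : ℝ := L * x + -L with hu
    have hLC : (L : ℂ) ≠ 0 := ofReal_ne_zero.2 hL0.ne'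
    have e1 : (x : ℂ) + (ε / L : ℝ) * I - 1 = ((u : ℂ) + ε * I) / L := by
      rw [hu]; push_cast; field_simp; ring
    have e2 : y ^ (1 + x) = y ^ 2 * Real.exp u := by
      rw [hy, ← Real.exp_mul, ← Real.exp_nat_mul, ← Real.exp_add, hu]; congr 1; push_cast; ring
    rw [e1, e2]
    have h := norm_cpow_mul_norm_le (u := u) hε hL hz
    have hexp : 0 ≤ Real.exp u := (Real.exp_pos u).le
    calc ‖(((u : ℂ) + ε * I) / L) ^ (-z)‖ * (y ^ 2 * Real.exp u) * (MQ * ‖((u : ℂ) + ε * I) / L‖)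
        = MQ * y ^ 2 * Real.exp u * (‖(((u : ℂ) + ε * I) / L) ^ (-z)‖ * ‖((u : ℂ) + ε * I) / L‖) := by
          ring
      _ ≤ MQ * y ^ 2 * Real.exp u * (Real.exp (π * R) * (u ^ 2 + 1) ^ ((1 + R) / 2) * L ^ (z.re - 1)) :=
          mul_le_mul_of_nonneg_left h (by positivity)
      _ = g x := by rw [hg]; simp only; ring
  have hba : b ≤ a := hb
  have hgc : Continuous g := by
    refine continuous_const.mul ((Real.continuous_exp.comp (by fun_prop)).mul ?_)
    exact Continuous.rpow_const (by fun_prop) fun x ↦ Or.inl (by positivity)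
  have h1 := intervalIntegral.norm_integral_le_of_norm_le (μ := volume) hba (f := f) (g := g)
    (Eventually.of_forall fun x hx ↦ hpt x (by rwa [uIoc_of_le hba])) (hgc.intervalIntegrable _ _)
  refine h1.trans ?_
  -- evaluate the bound integral by the substitution `u = L x − L`
  have hsub : ∫ x in b..a, Real.exp (L * x + -L) * ((L * x + -L) ^ 2 + 1) ^ ((1 + R) / 2) =
      L⁻¹ * ∫ u in (L * b + -L)..1, Real.exp u * (u ^ 2 + 1) ^ ((1 + R) / 2) := by
    have h := intervalIntegral.integral_comp_mul_add
      (f := fun u : ℝ ↦ Real.exp u * (u ^ 2 + 1) ^ ((1 + R) / 2)) (a := b) (b := a) hL0.ne' (-L)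
    rw [show L * a + -L = 1 by rw [ha]; field_simp; ring, smul_eq_mul] at h
    exact h
  have hw : ∫ u in (L * b + -L)..1, Real.exp u * (u ^ 2 + 1) ^ ((1 + R) / 2) ≤ K := by
    refine hweight _ ?_
    have h1 : L * b ≤ L * a := mul_le_mul_of_nonneg_left hba hL0.le
    have h2 : L * a = L + 1 := by rw [ha]; field_simp
    linarith
  rw [hg, intervalIntegral.integral_const_mul, hsub]
  have hpos : 0 ≤ Real.exp (π * R) * MQ * y ^ 2 * L ^ (z.re - 1) * L⁻¹ := by
    have : 0 ≤ L ^ (z.re - 1) := Real.rpow_nonneg hL0.le _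
    positivity
  calc Real.exp (π * R) * MQ * y ^ 2 * L ^ (z.re - 1) *
        (L⁻¹ * ∫ u in (L * b + -L)..1, Real.exp u * (u ^ 2 + 1) ^ ((1 + R) / 2))
      = (Real.exp (π * R) * MQ * y ^ 2 * L ^ (z.re - 1) * L⁻¹) *
          ∫ u in (L * b + -L)..1, Real.exp u * (u ^ 2 + 1) ^ ((1 + R) / 2) := by ring
    _ ≤ (Real.exp (π * R) * MQ * y ^ 2 * L ^ (z.re - 1) * L⁻¹) * K :=
        mul_le_mul_of_nonneg_left hw hpos
    _ = Real.exp (π * R) * K * MQ * y ^ 2 * L ^ (z.re - 2) := by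
        rw [show z.re - 2 = (z.re - 1) - 1 by ring, Real.rpow_sub_one hL0.ne' (z.re - 1)]
        ring

/-- **Right side of the keyhole, error part**: if `‖f(t)‖ ≤ ‖(s−1)^{−z}‖ y^{1+a} M_Q ‖s − 1‖` at
`s = a + it`, `|t| ≤ 1/L` (`a = 1 + 1/L`, `y = e^L`), then `‖∫_{−1/L}^{1/L} f‖ ≤ K M_Q y² L^{Re z − 2}`.
[cite: MontgomeryVaughan2007, §7.4 p. 178 ("On the semicircular part of 𝒞₂ …")] -/
theorem exists_norm_integral_right_edge_error (R : ℝ) (hR : 0 ≤ R) :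
    ∃ K : ℝ, 0 ≤ K ∧ ∀ (L : ℝ), 1 ≤ L → ∀ z : ℂ, ‖z‖ ≤ R → ∀ MQ : ℝ, 0 ≤ MQ → ∀ f : ℝ → ℂ,
      (∀ t ∈ Ι (-(1 / L)) (1 / L), ‖f t‖ ≤ ‖(((1 + 1 / L : ℝ) : ℂ) + (t : ℂ) * I - 1) ^ (-z)‖ *
        Real.exp L ^ (1 + (1 + 1 / L)) * (MQ * ‖(((1 + 1 / L : ℝ) : ℂ) + (t : ℂ) * I - 1)‖)) →
      ‖∫ t in (-(1 / L))..(1 / L), f t‖ ≤ K * MQ * Real.exp L ^ 2 * L ^ (z.re - 2) := by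
  refine ⟨2 * Real.exp (π * R) * Real.exp 1 * 2 ^ (1 + R), by positivity,
    fun L hL z hz MQ hMQ f hf ↦ ?_⟩
  have hL0 : 0 < L := by linarith
  set y : ℝ := Real.exp L with hy
  have hre : -z.re ≤ R := by linarith [neg_le_abs z.re, abs_re_le_norm z]
  have hre' : z.re ≤ R := (le_abs_self _).trans ((abs_re_le_norm z).trans hz)
  -- pointwise bound
  have hpt : ∀ t ∈ Ι (-(1 / L)) (1 / L), ‖f t‖ ≤
      Real.exp (π * R) * Real.exp 1 * 2 ^ (1 + R) * MQ * y ^ 2 * L ^ (z.re - 1) := by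
    intro t ht
    refine (hf t ht).trans ?_
    rw [uIoc_of_le (by rw [neg_le_self_iff]; positivity)] at ht
    set w : ℂ := ((1 + 1 / L : ℝ) : ℂ) + (t : ℂ) * I - 1 with hw
    have hwre : w.re = 1 / L := by simp [hw]
    have hwim : w.im = t := by simp [hw]
    have hw0 : w ≠ 0 := fun h ↦ by
      have := congrArg Complex.re h; rw [hwre] at this; simp at this; exact hL0.ne' this
    have hwpos : 0 < ‖w‖ := norm_pos_iff.2 hw0
    -- `1/L ≤ ‖w‖ ≤ √2/L ≤ 2/L`
    have hw1 : 1 / L ≤ ‖w‖ := by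
      have := abs_re_le_norm w; rwa [hwre, abs_of_pos (by positivity)] at this
    have hw2 : ‖w‖ ≤ 2 / L := by
      calc ‖w‖ ≤ |w.re| + |w.im| := Complex.norm_le_abs_re_add_abs_im w
        _ ≤ 1 / L + 1 / L := by
            rw [hwre, hwim, abs_of_pos (by positivity)]
            exact add_le_add le_rfl (abs_le.2 ⟨by linarith [ht.1], ht.2⟩)
        _ = 2 / L := by ring
    have hy1 : y ^ (1 + (1 + 1 / L)) = y ^ 2 * Real.exp 1 := by
      rw [hy, ← Real.exp_mul, show L * (1 + (1 + 1 / L)) = L * 2 + 1 by field_simp; ring,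
        Real.exp_add, Real.exp_mul, Real.rpow_two]
    -- `‖w^{-z}‖ ‖w‖ ≤ e^{πR} ‖w‖^{1 - Re z} ≤ e^{πR} 2^{(1+R)/2} L^{Re z - 1}`
    have hkey : ‖w ^ (-z)‖ * ‖w‖ ≤ Real.exp (π * R) * 2 ^ (1 + R) * L ^ (z.re - 1) := by
      have h1 : ‖w ^ (-z)‖ * ‖w‖ ≤ Real.exp (π * R) * ‖w‖ ^ (1 - z.re) := by
        calc ‖w ^ (-z)‖ * ‖w‖ ≤ (‖w‖ ^ (-z.re) * Real.exp (π * ‖z‖)) * ‖w‖ :=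
              mul_le_mul_of_nonneg_right (norm_cpow_neg_le hw0 z) (norm_nonneg _)
          _ = Real.exp (π * ‖z‖) * ‖w‖ ^ (1 - z.re) := by
              rw [show (1 - z.re) = -z.re + 1 by ring, Real.rpow_add hwpos, Real.rpow_one]; ring
          _ ≤ Real.exp (π * R) * ‖w‖ ^ (1 - z.re) :=
              mul_le_mul_of_nonneg_right (Real.exp_le_exp.2
                (mul_le_mul_of_nonneg_left hz Real.pi_pos.le)) (Real.rpow_nonneg (norm_nonneg _) _)
      -- `‖w‖^{1-Re z} ≤ 2^{(1+R)/2} L^{Re z - 1}` in both cases of the sign of `1 - Re z`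
      have h2 : ‖w‖ ^ (1 - z.re) ≤ 2 ^ (1 + R) * L ^ (z.re - 1) := by
        have hL' : L ^ (z.re - 1) = (1 / L) ^ (1 - z.re) := by
          rw [one_div, Real.inv_rpow hL0.le, ← Real.rpow_neg hL0.le]; congr 1; ring
        rw [hL']
        rcases le_or_gt 0 (1 - z.re) with hpos | hneg
        · calc ‖w‖ ^ (1 - z.re) ≤ (2 / L) ^ (1 - z.re) := Real.rpow_le_rpow (norm_nonneg _) hw2 hpos
            _ = 2 ^ (1 - z.re) * (1 / L) ^ (1 - z.re) := by
                rw [div_eq_mul_one_div, Real.mul_rpow (by norm_num) (by positivity)]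
            _ ≤ 2 ^ (1 + R) * (1 / L) ^ (1 - z.re) :=
                mul_le_mul_of_nonneg_right (Real.rpow_le_rpow_of_exponent_le (by norm_num)
                  (by linarith)) (Real.rpow_nonneg (by positivity) _)
        · calc ‖w‖ ^ (1 - z.re) ≤ (1 / L) ^ (1 - z.re) :=
              Real.rpow_le_rpow_of_nonpos (by positivity) hw1 hneg.le
            _ ≤ 2 ^ (1 + R) * (1 / L) ^ (1 - z.re) := by
                have : 1 ≤ (2 : ℝ) ^ (1 + R) := Real.one_le_rpow (by norm_num) (by positivity)
                have h0 : 0 ≤ (1 / L) ^ (1 - z.re) := Real.rpow_nonneg (by positivity) _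
                nlinarith
      calc ‖w ^ (-z)‖ * ‖w‖ ≤ Real.exp (π * R) * ‖w‖ ^ (1 - z.re) := h1
        _ ≤ Real.exp (π * R) * (2 ^ (1 + R) * L ^ (z.re - 1)) :=
            mul_le_mul_of_nonneg_left h2 (Real.exp_pos _).le
        _ = _ := by ring
    rw [hy1]
    calc ‖w ^ (-z)‖ * (y ^ 2 * Real.exp 1) * (MQ * ‖w‖)
        = Real.exp 1 * MQ * y ^ 2 * (‖w ^ (-z)‖ * ‖w‖) := by ring
      _ ≤ Real.exp 1 * MQ * y ^ 2 * (Real.exp (π * R) * 2 ^ (1 + R) * L ^ (z.re - 1)) :=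
          mul_le_mul_of_nonneg_left hkey (by positivity)
      _ = _ := by ring
  have h := intervalIntegral.norm_integral_le_of_norm_le_const hpt
  refine h.trans ?_
  have h2L : 0 < 1 / L := by positivity
  rw [show |1 / L - -(1 / L)| = 2 / L by rw [abs_of_nonneg (by linarith)]; ring]
  rw [show z.re - 2 = (z.re - 1) - 1 by ring, Real.rpow_sub_one hL0.ne' (z.re - 1)]
  apply le_of_eq
  ring


/-! ### The sides of the keyhole in the coordinates of the final assembly -/

/-- Lower side, main part, in the form produced by `integral_line_eq_keyhole`. [folklore] -/
theorem integral_lower_edge_main {L : ℝ} (hL : 0 < L) (b : ℝ) (z : ℂ) :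
    ∫ x in b..(1 + 1 / L), ((x : ℂ) + ((-(1 / L) : ℝ) : ℂ) * I - 1) ^ (-z) *
        ((Real.exp L : ℝ) : ℂ) ^ (1 + ((x : ℂ) + ((-(1 / L) : ℝ) : ℂ) * I)) =
      ((Real.exp L : ℝ) : ℂ) ^ 2 * (L : ℂ) ^ (z - 1) *
        ∫ u in (-(L * (1 - b)))..1, exp (((u : ℂ) - I) - z * log ((u : ℂ) - I)) := by
  have h := integral_horizontal_edge_main hL b z (-1) (by norm_num)
  have e1 : ∀ x : ℝ, (x : ℂ) + ((-1 / L : ℝ) : ℂ) * I = (x : ℂ) + ((-(1 / L) : ℝ) : ℂ) * I := by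
    intro x; push_cast; ring
  have e2 : ∀ u : ℝ, (u : ℂ) + ((-1 : ℝ) : ℂ) * I = (u : ℂ) - I := by
    intro u; push_cast; ring
  simp_rw [e1, e2] at h
  exact h

/-- Upper side, main part, in the form produced by `integral_line_eq_keyhole`. [folklore] -/
theorem integral_upper_edge_main {L : ℝ} (hL : 0 < L) (b : ℝ) (z : ℂ) :
    ∫ x in b..(1 + 1 / L), ((x : ℂ) + ((1 / L : ℝ) : ℂ) * I - 1) ^ (-z) *
        ((Real.exp L : ℝ) : ℂ) ^ (1 + ((x : ℂ) + ((1 / L : ℝ) : ℂ) * I)) =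
      ((Real.exp L : ℝ) : ℂ) ^ 2 * (L : ℂ) ^ (z - 1) *
        ∫ u in (-(L * (1 - b)))..1, exp (((u : ℂ) + I) - z * log ((u : ℂ) + I)) := by
  have h := integral_horizontal_edge_main hL b z 1 (by norm_num)
  have e2 : ∀ u : ℝ, (u : ℂ) + ((1 : ℝ) : ℂ) * I = (u : ℂ) + I := by
    intro u; push_cast; ring
  simp_rw [e2] at h
  exact h

/-! ### Parameters of the contour -/

/-- **The parameters** `T = exp(√L)`, `ℓ = log(T + 3)` for `L ≥ 4`: `T ≥ 3`, `√L ≤ ℓ ≤ 2√L`,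
`2 ≤ √L ≤ L`. [cite: MontgomeryVaughan2007, §7.4 p. 177 ("We take T = exp(√log x)")] -/
theorem params {L : ℝ} (hL : 4 ≤ L) :
    3 ≤ Real.exp (Real.sqrt L) ∧ Real.sqrt L ≤ Real.log (Real.exp (Real.sqrt L) + 3) ∧
      Real.log (Real.exp (Real.sqrt L) + 3) ≤ 2 * Real.sqrt L ∧ 2 ≤ Real.sqrt L ∧ Real.sqrt L ≤ L := by
  have hs2 : 2 ≤ Real.sqrt L := by
    rw [Real.le_sqrt' (by norm_num : (0 : ℝ) < 2)]
    linarith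
  set T : ℝ := Real.exp (Real.sqrt L) with hT
  have hT3 : 3 ≤ T := by
    have h1 : Real.sqrt L + 1 ≤ T := Real.add_one_le_exp _
    linarith
  have hT0 : 0 < T := by linarith
  have hlogT : Real.log T = Real.sqrt L := Real.log_exp _
  refine ⟨hT3, ?_, ?_, hs2, ?_⟩
  · rw [← hlogT]; exact Real.log_le_log hT0 (by linarith)
  · have h : T + 3 ≤ T ^ 2 := by nlinarith
    calc Real.log (T + 3) ≤ Real.log (T ^ 2) := Real.log_le_log (by linarith) h
      _ = 2 * Real.sqrt L := by rw [Real.log_pow, hlogT]; ring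
  · calc Real.sqrt L ≤ Real.sqrt L * Real.sqrt L := le_mul_of_one_le_right (by linarith) (by linarith)
      _ = L := Real.mul_self_sqrt (by linarith)


/-- Lower side, error part, in the form produced by `integral_line_eq_keyhole`. [folklore] -/
theorem exists_norm_integral_lower_edge_error (R : ℝ) :
    ∃ K : ℝ, 0 ≤ K ∧ ∀ (L : ℝ), 1 ≤ L → ∀ b : ℝ, b ≤ 1 + 1 / L → ∀ z : ℂ, ‖z‖ ≤ R →
      ∀ MQ : ℝ, 0 ≤ MQ → ∀ f : ℝ → ℂ,
      (∀ x ∈ Ι b (1 + 1 / L), ‖f x‖ ≤ ‖((x : ℂ) + ((-(1 / L) : ℝ) : ℂ) * I - 1) ^ (-z)‖ *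
        Real.exp L ^ (1 + x) * (MQ * ‖(x : ℂ) + ((-(1 / L) : ℝ) : ℂ) * I - 1‖)) →
      ‖∫ x in b..(1 + 1 / L), f x‖ ≤ K * MQ * Real.exp L ^ 2 * L ^ (z.re - 2) := by
  obtain ⟨K, hK, h⟩ := exists_norm_integral_horizontal_edge_error R
  refine ⟨K, hK, fun L hL b hb z hz MQ hMQ f hf ↦ h L hL b hb z hz (-1) (Or.inr rfl) MQ hMQ f ?_⟩
  intro x hx
  have e : ((-1 / L : ℝ) : ℂ) = ((-(1 / L) : ℝ) : ℂ) := by push_cast; ring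
  rw [e]
  exact hf x hx

/-- Upper side, error part, in the form produced by `integral_line_eq_keyhole`. [folklore] -/
theorem exists_norm_integral_upper_edge_error (R : ℝ) :
    ∃ K : ℝ, 0 ≤ K ∧ ∀ (L : ℝ), 1 ≤ L → ∀ b : ℝ, b ≤ 1 + 1 / L → ∀ z : ℂ, ‖z‖ ≤ R →
      ∀ MQ : ℝ, 0 ≤ MQ → ∀ f : ℝ → ℂ,
      (∀ x ∈ Ι b (1 + 1 / L), ‖f x‖ ≤ ‖((x : ℂ) + ((1 / L : ℝ) : ℂ) * I - 1) ^ (-z)‖ *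
        Real.exp L ^ (1 + x) * (MQ * ‖(x : ℂ) + ((1 / L : ℝ) : ℂ) * I - 1‖)) →
      ‖∫ x in b..(1 + 1 / L), f x‖ ≤ K * MQ * Real.exp L ^ 2 * L ^ (z.re - 2) := by
  obtain ⟨K, hK, h⟩ := exists_norm_integral_horizontal_edge_error R
  exact ⟨K, hK, fun L hL b hb z hz MQ hMQ f hf ↦ h L hL b hb z hz 1 (Or.inl rfl) MQ hMQ f hf⟩

/-- The main factor `M(s) = (s − 1)^{−z} y^{1+s}` is holomorphic off the cut `s − 1 ∈ (−∞, 0]`.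
[folklore] -/
theorem differentiableOn_mainFactor (y : ℝ) (hy : 0 < y) (z : ℂ) :
    DifferentiableOn ℂ (fun s : ℂ ↦ (s - 1) ^ (-z) * (y : ℂ) ^ (1 + s)) {s : ℂ | s - 1 ∈ slitPlane} := by
  intro s hs
  have h1 : DifferentiableAt ℂ (fun s : ℂ ↦ (s - 1) ^ (-z)) s :=
    (differentiableAt_id.sub_const 1).cpow_const hs
  have h2 : DifferentiableAt ℂ (fun s : ℂ ↦ (y : ℂ) ^ (1 + s)) s :=
    (differentiableAt_id.const_add 1).const_cpow (Or.inl (ofReal_ne_zero.2 hy.ne'))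
  exact (h1.mul h2).differentiableWithinAt

/-- From `L^A ≤ C e^{c√L}` to `e^{−c√L} ≤ C L^{−A}`. [folklore] -/
theorem exp_neg_le_of_rpow_le {L A c C : ℝ} (hL : 0 < L) (h : L ^ A ≤ C * Real.exp (c * Real.sqrt L)) :
    Real.exp (-(c * Real.sqrt L)) ≤ C * L ^ (-A) := by
  have e : Real.exp (-(c * Real.sqrt L)) = L ^ (-A) * (L ^ A * Real.exp (-(c * Real.sqrt L))) := by
    rw [← mul_assoc, ← Real.rpow_add hL, neg_add_cancel, Real.rpow_zero, one_mul]
  rw [e]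
  have h0 : 0 ≤ L ^ (-A) := Real.rpow_nonneg hL.le _
  calc L ^ (-A) * (L ^ A * Real.exp (-(c * Real.sqrt L)))
      ≤ L ^ (-A) * (C * Real.exp (c * Real.sqrt L) * Real.exp (-(c * Real.sqrt L))) :=
        mul_le_mul_of_nonneg_left (mul_le_mul_of_nonneg_right h (Real.exp_pos _).le) h0
    _ = C * L ^ (-A) := by
        rw [mul_assoc C, ← Real.exp_add, add_neg_cancel, Real.exp_zero, mul_one]; ring

/-! ### The Selberg–Delange asymptotic for the Riesz means `I_z(y)` -/

set_option maxHeartbeats 2000000 in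
/-- **Selberg–Delange for `∑ z^{ω(n)} (y − n)` (MV Theorems 7.17–7.18 for `ω`, Riesz-mean form).**
For every `R > 0` there are `C` and `L₀` such that for `L = log y ≥ L₀` and `‖z‖ ≤ R`,
`‖∑_{n ≤ y} z^{ω(n)} (y − n) − F(1,z)/(2Γ(z)) · y² (log y)^{z−1}‖ ≤ C y² (log y)^{Re z − 2}`.
[cite: MontgomeryVaughan2007, Theorems 7.17–7.18 and §7.4.1 Exercise 3] -/
theorem rieszMean_omegaCoeff_asymp (R : ℝ) (hR : 0 < R) :
    ∃ C : ℝ, 0 ≤ C ∧ ∃ L₀ : ℝ, 1 ≤ L₀ ∧ ∀ L : ℝ, L₀ ≤ L → ∀ z : ℂ, ‖z‖ ≤ R →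
      ‖(∑ n ∈ Finset.Ioc 0 ⌊Real.exp L⌋₊, omegaCoeff z n * (((Real.exp L : ℝ) : ℂ) - n)) -
        selbergF 1 z / (2 * Complex.Gamma z) * ((Real.exp L : ℝ) : ℂ) ^ 2 * (L : ℂ) ^ (z - 1)‖ ≤
        C * Real.exp L ^ 2 * L ^ (z.re - 2) := by
  -- the constants of the pieces
  obtain ⟨A', hA', htails⟩ := exists_norm_integral_tails_le R
  obtain ⟨Ah, hAh, hhoriz⟩ := exists_norm_integral_horizontal_le R
  obtain ⟨Af, hAf, hleftfar⟩ := exists_norm_integral_left_far_le R hR.le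
  obtain ⟨An, hAn, hleftnear⟩ := exists_norm_integral_left_near_le R hR.le
  obtain ⟨ρ, hρ, hρ8, MQ, hMQ, hQ⟩ := exists_lipschitz_Q R hR.le
  obtain ⟨Kl, hKl, hlowerr⟩ := exists_norm_integral_lower_edge_error R
  obtain ⟨Ku, hKu, huperr⟩ := exists_norm_integral_upper_edge_error R
  obtain ⟨Kr, hKr, hrighterr⟩ := exists_norm_integral_right_edge_error R hR.le
  obtain ⟨CH, hCH, hHankel⟩ := Literature.Analysis.Complex.Hankel.hankel_loop_sub_inv_Gamma_le R
  obtain ⟨B, hB, hFb⟩ := exists_bound_selbergF (by norm_num : (1 : ℝ) / 2 < 3 / 4) R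
  have hc := zfrConst_pos
  have hcle := zfrConst_le
  obtain ⟨C₁, hC₁, hdec1⟩ := exists_rpow_le_exp_sqrt (R + 2) (c := 1 / 2) (by norm_num)
  obtain ⟨C₂, hC₂, hdec2⟩ := exists_rpow_le_exp_sqrt (2 * R + 2) (c := zfrConst) hc
  obtain ⟨C₃, hC₃, hdec3⟩ := exists_rpow_le_exp_sqrt (2 * R + 2) (c := 2) (by norm_num)
  obtain ⟨C₄, hC₄, hdec4⟩ := exists_rpow_le_exp_sqrt 1 (c := zfrConst / 2) (by positivity)
  set c₁ : ℝ := 2 * zfrConst with hc₁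
  have hc₁pos : 0 < c₁ := by positivity
  -- the constant and the threshold
  set CONST : ℝ := 2 * A' * Real.exp 1 * C₁ + 2 * (An + Af) * 2 ^ R * C₂ + 2 * Ah * 2 ^ R * Real.exp 1 * C₃ +
    (Kl + Ku + Kr) * MQ + B / 2 * CH * C₄ with hCONST
  set L₀ : ℝ := max (max 4 (1 / zfrConst ^ 2)) (max ((3 * c₁ / ρ) ^ 2) (3 / ρ)) with hL₀
  refine ⟨CONST, by positivity, L₀, le_trans (by norm_num) ((le_max_left _ _).trans (le_max_left _ _)),
    fun L hL z hz ↦ ?_⟩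
  -- the parameters
  have hL4 : 4 ≤ L := le_trans ((le_max_left _ _).trans (le_max_left _ _)) hL
  have hLc : 1 / zfrConst ^ 2 ≤ L := le_trans ((le_max_right _ _).trans (le_max_left _ _)) hL
  have hLρ1 : (3 * c₁ / ρ) ^ 2 ≤ L := le_trans ((le_max_left _ _).trans (le_max_right _ _)) hL
  have hLρ2 : 3 / ρ ≤ L := le_trans ((le_max_right _ _).trans (le_max_right _ _)) hL
  have hL1 : 1 ≤ L := by linarith
  have hL0 : 0 < L := by linarith
  obtain ⟨hT3, hℓ1, hℓ2, hsqrt2, hsqrtL⟩ := params hL4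
  set y : ℝ := Real.exp L with hy
  have hy0 : 0 < y := Real.exp_pos L
  have hy1 : 1 ≤ y := Real.one_le_exp (by linarith)
  set a : ℝ := 1 + 1 / L with ha
  set δ : ℝ := 1 / L with hδ
  set T : ℝ := Real.exp (Real.sqrt L) with hT
  set ℓ : ℝ := Real.log (T + 3) with hℓ
  set b : ℝ := 1 - c₁ / ℓ with hb
  set β : ℝ := L * (1 - b) with hβ
  have hδ0 : 0 < δ := by positivity
  have hδ1 : δ ≤ 1 := by rw [hδ, div_le_one hL0]; exact hL1
  have ha1 : 1 < a := by rw [ha]; linarith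
  have ha2 : a ≤ 2 := by rw [ha]; linarith
  have hT1 : 1 ≤ T := by linarith
  have hδT : δ ≤ T := by linarith
  have hℓ0 : 0 < ℓ := by linarith
  have hℓ4 : Real.log 4 ≤ ℓ := Real.log_le_log (by norm_num) (by linarith)
  have h1b : 1 - b = c₁ / ℓ := by rw [hb]; ring
  have hc₁ℓ : c₁ / ℓ ≤ c₁ / 2 := div_le_div_of_nonneg_left hc₁pos.le (by norm_num) (by linarith)
  have hc₁small : c₁ ≤ 1 / 50 := by rw [hc₁]; linarith
  have hb34 : 3 / 4 ≤ b := by rw [hb]; linarith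
  have hba : b ≤ a := by
    have : 0 ≤ c₁ / ℓ := by positivity
    rw [hb, ha]; linarith
  have hb2 : b ≤ 2 := by linarith
  have hbw : 1 - zfrWidth 1 / 2 ≤ b := by
    have hw : zfrWidth 1 = 4 * zfrConst / Real.log 4 := by
      simp [zfrWidth, abs_one]; norm_num
    rw [hw, hb, hc₁]
    have hlog4 : 0 < Real.log 4 := Real.log_pos (by norm_num)
    have : 2 * zfrConst / ℓ ≤ 2 * zfrConst / Real.log 4 :=
      div_le_div_of_nonneg_left (by positivity) hlog4 hℓ4
    have e : 4 * zfrConst / Real.log 4 / 2 = 2 * zfrConst / Real.log 4 := by ring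
    rw [e]; linarith
  have hreg : 1 - 4 * zfrConst / Real.log (T + 3) < b := by
    rw [hb, hc₁, ← hℓ]
    have : 0 < zfrConst / ℓ := by positivity
    have e1 : 4 * zfrConst / ℓ = 4 * (zfrConst / ℓ) := by ring
    have e2 : 2 * zfrConst / ℓ = 2 * (zfrConst / ℓ) := by ring
    rw [e1, e2]; linarith
  -- `β ≥ c̄ √L ≥ 1`
  have hβge : zfrConst * Real.sqrt L ≤ β := by
    rw [hβ, h1b, hc₁]
    have hsq : Real.sqrt L * Real.sqrt L = L := Real.mul_self_sqrt hL0.le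
    rw [mul_div_assoc', le_div_iff₀ hℓ0]
    calc zfrConst * Real.sqrt L * ℓ ≤ zfrConst * Real.sqrt L * (2 * Real.sqrt L) :=
          mul_le_mul_of_nonneg_left hℓ2 (by positivity)
      _ = L * (2 * zfrConst) := by
          rw [show zfrConst * Real.sqrt L * (2 * Real.sqrt L) =
            2 * zfrConst * (Real.sqrt L * Real.sqrt L) by ring, hsq]; ring
  have hβ1 : 1 ≤ β := by
    refine le_trans ?_ hβge
    have h1 : 1 / zfrConst ≤ Real.sqrt L := by
      rw [Real.le_sqrt' (by positivity)]
      rwa [div_pow, one_pow] 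
    calc (1 : ℝ) = zfrConst * (1 / zfrConst) := by field_simp
      _ ≤ zfrConst * Real.sqrt L := mul_le_mul_of_nonneg_left h1 hc.le
  -- the edges stay within the Lipschitz radius: `c₁/ℓ + 2/L ≤ ρ`
  have hedgeρ : c₁ / ℓ + 2 / L ≤ ρ := by
    have h1 : c₁ / ℓ ≤ c₁ / Real.sqrt L := div_le_div_of_nonneg_left hc₁pos.le (by linarith) hℓ1
    have h2 : c₁ / Real.sqrt L ≤ ρ / 3 := by
      have h3 : 3 * c₁ / ρ ≤ Real.sqrt L := by
        rw [Real.le_sqrt' (by positivity)]; exact hLρ1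
      rw [div_le_iff₀ (by linarith)]
      rw [div_le_iff₀ hρ] at h3
      linarith
    have h4 : 2 / L ≤ 2 * ρ / 3 := by
      rw [div_le_iff₀ hL0]
      rw [div_le_iff₀ hρ] at hLρ2
      linarith
    linarith
  ------------------------------------------------------------------
  -- the integrand and its analytic properties
  ------------------------------------------------------------------
  set Ψ : ℂ → ℂ := fun s ↦ (y : ℂ) ^ (1 + s) *
    (selbergF s z * exp (z * (logZeta₁ s - log (s - 1)))) * kernel s with hΨdef
  have hΨ : ∀ s, Ψ s = (y : ℂ) ^ (1 + s) *
      (selbergF s z * exp (z * (logZeta₁ s - log (s - 1)))) * kernel s := fun s ↦ rfl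
  have hdiffΨ : DifferentiableOn ℂ Ψ zfrSlitRegion := differentiableOn_integrand hy0 z
  have hcontΨ : ContinuousOn Ψ zfrSlitRegion := hdiffΨ.continuousOn
  -- region bookkeeping
  have hregion : ∀ s : ℂ, |s.im| ≤ T → b ≤ s.re → s ∈ zfrRegion := fun s hs1 hs2 ↦
    mem_zfrRegion_of_le hs1 (lt_of_lt_of_le hreg hs2)
  have hslit : ∀ s : ℂ, |s.im| ≤ T → b ≤ s.re → s.im ≠ 0 → s ∈ zfrSlitRegion := fun s hs1 hs2 hs3 ↦
    mem_zfrSlitRegion_of_im_ne_zero (hregion s hs1 hs2) hs3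
  ------------------------------------------------------------------
  -- Step A: Perron's formula
  ------------------------------------------------------------------
  have hPerron := rieszMean_eq_integral hy0 z ha1
  have hint : Integrable fun t : ℝ ↦ Ψ ((a : ℂ) + t * I) := integrable_integrand_line hy0 z ha1
  ------------------------------------------------------------------
  -- Step B: the keyhole deformation
  ------------------------------------------------------------------
  have hdiff_top : DifferentiableOn ℂ Ψ (Icc b a ×ℂ Icc δ T) := by
    refine hdiffΨ.mono fun s hs ↦ hslit s ?_ hs.1.1 ?_
    · exact abs_le.2 ⟨by linarith [hs.2.1], hs.2.2⟩
    · intro h; have := hs.2.1; rw [h] at this; linarith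
  have hdiff_bot : DifferentiableOn ℂ Ψ (Icc b a ×ℂ Icc (-T) (-δ)) := by
    refine hdiffΨ.mono fun s hs ↦ hslit s ?_ hs.1.1 ?_
    · exact abs_le.2 ⟨hs.2.1, by linarith [hs.2.2]⟩
    · intro h; have := hs.2.2; rw [h] at this; linarith
  have hkey := integral_line_eq_keyhole (Ψ := Ψ) hδT hba hdiff_top hdiff_bot hint
  ------------------------------------------------------------------
  -- Step C: bounds for the remainder pieces
  ------------------------------------------------------------------
  -- decay factors
  have hy2 : y ^ 2 = Real.exp (L + L) := by rw [hy, sq, ← Real.exp_add]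
  have hya : y ^ (1 + a) = y ^ 2 * Real.exp 1 := by
    rw [hy2, hy, ← Real.exp_mul, ← Real.exp_add]
    congr 1
    rw [ha, hδ]; field_simp; ring
  have hyb : y ^ (1 + b) ≤ y ^ 2 * Real.exp (-(zfrConst * Real.sqrt L)) := by
    rw [hy2, hy, ← Real.exp_mul, ← Real.exp_add, Real.exp_le_exp]
    have : L * (1 + b) = L + L - β := by rw [hβ]; ring
    rw [this]; linarith
  have hTrpow : T ^ (-(1 / 2 : ℝ)) = Real.exp (-(1 / 2 * Real.sqrt L)) := by
    rw [hT, ← Real.exp_mul]; congr 1; ring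
  have hT2 : T ^ 2 = Real.exp (2 * Real.sqrt L) := by
    rw [hT, ← Real.exp_nat_mul]; norm_num
  have hℓR : ℓ ^ R ≤ (2 * L) ^ R :=
    Real.rpow_le_rpow hℓ0.le (by linarith) hR.le
  have h2δR : (2 / δ) ^ R = (2 * L) ^ R := by rw [hδ]; congr 1; field_simp
  have h2LR : (2 * L) ^ R = 2 ^ R * L ^ R := Real.mul_rpow (by norm_num) hL0.le
  -- decay versus powers of `L`
  have hLpow : ∀ A : ℝ, L ^ (-(A)) ≤ L ^ (z.re - 2) → True := fun _ _ ↦ trivial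
  have hRez : -(R + 2) ≤ z.re - 2 := by linarith [neg_le_abs z.re, abs_re_le_norm z]
  have hLRe : L ^ (-(R + 2)) ≤ L ^ (z.re - 2) := Real.rpow_le_rpow_of_exponent_le hL1 hRez
  have hLRe0 : 0 ≤ L ^ (z.re - 2) := Real.rpow_nonneg hL0.le _
  -- (1) tails
  obtain ⟨htail1, htail2⟩ := htails y hy0 a T ha1.le ha2 hT1 z hz Ψ hΨ
  have hTails : ‖I * ((∫ t in Iic (-T), Ψ ((a : ℂ) + t * I)) + ∫ t in Ioi T, Ψ ((a : ℂ) + t * I))‖ ≤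
      2 * A' * Real.exp 1 * C₁ * y ^ 2 * L ^ (z.re - 2) := by
    rw [norm_mul, Complex.norm_I, one_mul]
    have hdec : Real.exp (-(1 / 2 * Real.sqrt L)) ≤ C₁ * L ^ (-(R + 2)) :=
      exp_neg_le_of_rpow_le hL0 (hdec1 L hL1)
    calc ‖(∫ t in Iic (-T), Ψ ((a : ℂ) + t * I)) + ∫ t in Ioi T, Ψ ((a : ℂ) + t * I)‖
        ≤ A' * y ^ (1 + a) * T ^ (-(1 / 2 : ℝ)) + A' * y ^ (1 + a) * T ^ (-(1 / 2 : ℝ)) :=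
          (norm_add_le _ _).trans (add_le_add htail2 htail1)
      _ = 2 * A' * Real.exp 1 * y ^ 2 * Real.exp (-(1 / 2 * Real.sqrt L)) := by rw [hya, hTrpow]; ring
      _ ≤ 2 * A' * Real.exp 1 * y ^ 2 * (C₁ * L ^ (-(R + 2))) := by gcongr
      _ ≤ 2 * A' * Real.exp 1 * y ^ 2 * (C₁ * L ^ (z.re - 2)) := by gcongr
      _ = _ := by ring
  -- (2) the left verticals on `σ = b`
  obtain ⟨hfar1, hfar2⟩ := hleftfar y hy0 b T hb34 hb2 hT1 hreg z hz Ψ hΨ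
  obtain ⟨hnear1, hnear2⟩ := hleftnear y hy0 b δ hb34 hbw hb2 hδ0 hδ1 z hz Ψ hΨ
  have hvint : ∀ c d : ℝ, δ ≤ c → c ≤ d → d ≤ T →
      IntervalIntegrable (fun t : ℝ ↦ Ψ ((b : ℂ) + t * I)) volume c d := by
    intro c d hc hcd hd
    refine Literature.Analysis.Complex.intervalIntegrable_vertical_of_continuousOn hcontΨ b hcd
      fun t ht ↦ hslit _ ?_ ?_ ?_
    · simp only [add_im, ofReal_im, mul_im, ofReal_re, I_im, mul_one, I_re, mul_zero, add_zero, zero_add]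
      exact abs_le.2 ⟨by linarith [ht.1], by linarith [ht.2]⟩
    · simp
    · simp only [add_im, ofReal_im, mul_im, ofReal_re, I_im, mul_one, I_re, mul_zero, add_zero, zero_add]
      intro h; linarith [ht.1]
  have hvint' : ∀ c d : ℝ, -T ≤ c → c ≤ d → d ≤ -δ →
      IntervalIntegrable (fun t : ℝ ↦ Ψ ((b : ℂ) + t * I)) volume c d := by
    intro c d hc hcd hd
    refine Literature.Analysis.Complex.intervalIntegrable_vertical_of_continuousOn hcontΨ b hcd
      fun t ht ↦ hslit _ ?_ ?_ ?_
    · simp only [add_im, ofReal_im, mul_im, ofReal_re, I_im, mul_one, I_re, mul_zero, add_zero, zero_add]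
      exact abs_le.2 ⟨by linarith [ht.1], by linarith [ht.2]⟩
    · simp
    · simp only [add_im, ofReal_im, mul_im, ofReal_re, I_im, mul_one, I_re, mul_zero, add_zero, zero_add]
      intro h; linarith [ht.2]
  have hdecb : Real.exp (-(zfrConst * Real.sqrt L)) ≤ C₂ * L ^ (-(2 * R + 2)) :=
    exp_neg_le_of_rpow_le hL0 (hdec2 L hL1)
  have hLeft : ‖I * ((∫ t in (-T)..(-δ), Ψ ((b : ℂ) + t * I)) + ∫ t in δ..T, Ψ ((b : ℂ) + t * I))‖ ≤
      2 * (An + Af) * 2 ^ R * C₂ * y ^ 2 * L ^ (z.re - 2) := by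
    rw [norm_mul, Complex.norm_I, one_mul]
    have hsplit1 : ∫ t in δ..T, Ψ ((b : ℂ) + t * I) =
        (∫ t in δ..(1 : ℝ), Ψ ((b : ℂ) + t * I)) + ∫ t in (1 : ℝ)..T, Ψ ((b : ℂ) + t * I) :=
      (intervalIntegral.integral_add_adjacent_intervals (hvint δ 1 le_rfl hδ1 hT1)
        (hvint 1 T hδ1 hT1 le_rfl)).symm
    have hsplit2 : ∫ t in (-T)..(-δ), Ψ ((b : ℂ) + t * I) =
        (∫ t in (-T)..(-1 : ℝ), Ψ ((b : ℂ) + t * I)) + ∫ t in (-1 : ℝ)..(-δ), Ψ ((b : ℂ) + t * I) :=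
      (intervalIntegral.integral_add_adjacent_intervals (hvint' (-T) (-1) le_rfl (by linarith) (by linarith))
        (hvint' (-1) (-δ) (by linarith) (by linarith) le_rfl)).symm
    have hsum : ‖(∫ t in (-T)..(-δ), Ψ ((b : ℂ) + t * I)) + ∫ t in δ..T, Ψ ((b : ℂ) + t * I)‖ ≤
        2 * (An * (2 / δ) ^ R * y ^ (1 + b) + Af * ℓ ^ R * y ^ (1 + b)) := by
      rw [hsplit1, hsplit2]
      calc ‖(∫ t in (-T)..(-1 : ℝ), Ψ ((b : ℂ) + t * I)) + (∫ t in (-1 : ℝ)..(-δ), Ψ ((b : ℂ) + t * I)) +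
            ((∫ t in δ..(1 : ℝ), Ψ ((b : ℂ) + t * I)) + ∫ t in (1 : ℝ)..T, Ψ ((b : ℂ) + t * I))‖
          ≤ (‖∫ t in (-T)..(-1 : ℝ), Ψ ((b : ℂ) + t * I)‖ + ‖∫ t in (-1 : ℝ)..(-δ), Ψ ((b : ℂ) + t * I)‖) +
            (‖∫ t in δ..(1 : ℝ), Ψ ((b : ℂ) + t * I)‖ + ‖∫ t in (1 : ℝ)..T, Ψ ((b : ℂ) + t * I)‖) :=
            (norm_add_le _ _).trans (add_le_add (norm_add_le _ _) (norm_add_le _ _))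
        _ ≤ (Af * ℓ ^ R * y ^ (1 + b) + An * (2 / δ) ^ R * y ^ (1 + b)) +
            (An * (2 / δ) ^ R * y ^ (1 + b) + Af * ℓ ^ R * y ^ (1 + b)) :=
            add_le_add (add_le_add hfar2 hnear2) (add_le_add hnear1 hfar1)
        _ = _ := by ring
    refine hsum.trans ?_
    rw [h2δR]
    have hyb' : 0 ≤ y ^ (1 + b) := Real.rpow_nonneg hy0.le _
    have hLR : 0 ≤ L ^ R := Real.rpow_nonneg hL0.le _
    -- `(2L)^R y^{1+b} ≤ 2^R L^R y² e^{-c̄√L} ≤ 2^R y² C₂ L^{-R-2}·L^R… ≤ 2^R C₂ y² L^{Re z - 2}`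
    have hkey2 : (2 * L) ^ R * y ^ (1 + b) ≤ 2 ^ R * C₂ * y ^ 2 * L ^ (z.re - 2) := by
      rw [h2LR]
      calc 2 ^ R * L ^ R * y ^ (1 + b) ≤ 2 ^ R * L ^ R * (y ^ 2 * Real.exp (-(zfrConst * Real.sqrt L))) := by
            gcongr
        _ ≤ 2 ^ R * L ^ R * (y ^ 2 * (C₂ * L ^ (-(2 * R + 2)))) := by gcongr
        _ = 2 ^ R * C₂ * y ^ 2 * (L ^ R * L ^ (-(2 * R + 2))) := by ring
        _ = 2 ^ R * C₂ * y ^ 2 * L ^ (-(R + 2)) := by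
            rw [← Real.rpow_add hL0]; congr 2; ring
        _ ≤ 2 ^ R * C₂ * y ^ 2 * L ^ (z.re - 2) := by gcongr
    have hℓy : Af * (ℓ ^ R * y ^ (1 + b)) ≤ Af * ((2 * L) ^ R * y ^ (1 + b)) :=
      mul_le_mul_of_nonneg_left (mul_le_mul_of_nonneg_right hℓR hyb') hAf
    calc 2 * (An * (2 * L) ^ R * y ^ (1 + b) + Af * ℓ ^ R * y ^ (1 + b))
        = 2 * (An * ((2 * L) ^ R * y ^ (1 + b)) + Af * (ℓ ^ R * y ^ (1 + b))) := by ring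
      _ ≤ 2 * (An * ((2 * L) ^ R * y ^ (1 + b)) + Af * ((2 * L) ^ R * y ^ (1 + b))) := by
          linarith [hℓy]
      _ = 2 * (An + Af) * ((2 * L) ^ R * y ^ (1 + b)) := by ring
      _ ≤ 2 * (An + Af) * (2 ^ R * C₂ * y ^ 2 * L ^ (z.re - 2)) :=
          mul_le_mul_of_nonneg_left hkey2 (by positivity)
      _ = _ := by ring
  -- (3) the horizontal sides `t = ±T`
  have hhor1 := hhoriz y hy1 a b T hb34 hba ha2 hT1 hreg z hz Ψ hΨ T (Or.inl rfl)
  have hhor2 := hhoriz y hy1 a b T hb34 hba ha2 hT1 hreg z hz Ψ hΨ (-T) (Or.inr rfl)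
  have hdecT : Real.exp (-(2 * Real.sqrt L)) ≤ C₃ * L ^ (-(2 * R + 2)) :=
    exp_neg_le_of_rpow_le hL0 (hdec3 L hL1)
  have hHoriz : ‖(∫ x in b..a, Ψ ((x : ℂ) + T * I)) - ∫ x in b..a, Ψ ((x : ℂ) + ((-T : ℝ) : ℂ) * I)‖ ≤
      2 * Ah * 2 ^ R * Real.exp 1 * C₃ * y ^ 2 * L ^ (z.re - 2) := by
    have hℓR' : 0 ≤ ℓ ^ R := Real.rpow_nonneg hℓ0.le _
    have hkey3 : Ah * ℓ ^ R * y ^ (1 + a) / T ^ 2 ≤ Ah * 2 ^ R * Real.exp 1 * C₃ * y ^ 2 * L ^ (z.re - 2) := by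
      rw [hya, hT2, div_eq_mul_inv, ← Real.exp_neg]
      calc Ah * ℓ ^ R * (y ^ 2 * Real.exp 1) * Real.exp (-(2 * Real.sqrt L))
          ≤ Ah * (2 * L) ^ R * (y ^ 2 * Real.exp 1) * (C₃ * L ^ (-(2 * R + 2))) := by gcongr
        _ = Ah * 2 ^ R * Real.exp 1 * C₃ * y ^ 2 * (L ^ R * L ^ (-(2 * R + 2))) := by rw [h2LR]; ring
        _ = Ah * 2 ^ R * Real.exp 1 * C₃ * y ^ 2 * L ^ (-(R + 2)) := by
            rw [← Real.rpow_add hL0]; congr 2; ring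
        _ ≤ Ah * 2 ^ R * Real.exp 1 * C₃ * y ^ 2 * L ^ (z.re - 2) := by gcongr
    calc ‖(∫ x in b..a, Ψ ((x : ℂ) + T * I)) - ∫ x in b..a, Ψ ((x : ℂ) + ((-T : ℝ) : ℂ) * I)‖
        ≤ ‖∫ x in b..a, Ψ ((x : ℂ) + T * I)‖ + ‖∫ x in b..a, Ψ ((x : ℂ) + ((-T : ℝ) : ℂ) * I)‖ :=
          norm_sub_le _ _
      _ ≤ Ah * ℓ ^ R * y ^ (1 + a) / T ^ 2 + Ah * ℓ ^ R * y ^ (1 + a) / T ^ 2 := add_le_add hhor1 hhor2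
      _ ≤ 2 * (Ah * 2 ^ R * Real.exp 1 * C₃ * y ^ 2 * L ^ (z.re - 2)) := by linarith
      _ = _ := by ring
  clear htails hhoriz hleftfar hleftnear htail1 htail2 hfar1 hfar2 hnear1 hnear2 hhor1 hhor2 hvint hvint'
  ------------------------------------------------------------------
  -- Step D: the keyhole around `s = 1` (MV's `𝒞₂`): main term and edge errors
  ------------------------------------------------------------------
  set Q1 : ℂ := selbergF 1 z / 2 with hQ1
  have hQ1norm : ‖Q1‖ ≤ B / 2 := by
    rw [hQ1, norm_div, Complex.norm_two]
    exact div_le_div_of_nonneg_right (hFb 1 z (by norm_num) hz) (by norm_num)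
  have hcontM : ContinuousOn (fun s : ℂ ↦ (s - 1) ^ (-z) * (y : ℂ) ^ (1 + s)) {s : ℂ | s - 1 ∈ slitPlane} :=
    (differentiableOn_mainFactor y hy0 z).continuousOn
  -- the points of the three sides are close to `1` and off the cut
  have hρL : ∀ x ∈ Ι b a, ∀ ε : ℝ, (ε = δ ∨ ε = -δ) →
      ‖(x : ℂ) + (ε : ℂ) * I - 1‖ ≤ ρ ∧ (x : ℂ) + (ε : ℂ) * I ≠ 1 := by
    intro x hx ε hε
    rw [uIoc_of_le hba] at hx
    have hεabs : |ε| = δ := by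
      rcases hε with rfl | rfl
      · exact abs_of_pos hδ0
      · rw [abs_neg, abs_of_pos hδ0]
    constructor
    · calc ‖(x : ℂ) + (ε : ℂ) * I - 1‖ = ‖((x - 1 : ℝ) : ℂ) + (ε : ℂ) * I‖ := by push_cast; ring_nf
        _ ≤ |x - 1| + |ε| := Literature.Analysis.Complex.Hankel.norm_add_mul_I_le _ _
        _ ≤ (c₁ / ℓ + δ) + δ := by
            rw [hεabs]
            have hc₁ℓ0 : 0 ≤ c₁ / ℓ := by positivity
            refine add_le_add (abs_le.2 ⟨?_, ?_⟩) le_rfl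
            · have : 1 - b = c₁ / ℓ := h1b
              linarith [hx.1]
            · have : a - 1 = δ := by rw [ha, hδ]; ring
              linarith [hx.2]
        _ = c₁ / ℓ + 2 / L := by rw [hδ]; ring
        _ ≤ ρ := hedgeρ
    · intro h
      have := congrArg Complex.im h
      simp at this
      rcases hε with rfl | rfl
      · exact hδ0.ne' this
      · exact hδ0.ne' (by linarith)
  have hρR : ∀ t ∈ Ι (-δ) δ, ‖(a : ℂ) + (t : ℂ) * I - 1‖ ≤ ρ ∧ (a : ℂ) + (t : ℂ) * I ≠ 1 := by
    intro t ht
    rw [uIoc_of_le (by linarith)] at ht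
    constructor
    · calc ‖(a : ℂ) + (t : ℂ) * I - 1‖ = ‖((a - 1 : ℝ) : ℂ) + (t : ℂ) * I‖ := by push_cast; ring_nf
        _ ≤ |a - 1| + |t| := Literature.Analysis.Complex.Hankel.norm_add_mul_I_le _ _
        _ ≤ δ + δ := by
            rw [show a - 1 = δ by rw [ha, hδ]; ring, abs_of_pos hδ0]
            exact add_le_add le_rfl (abs_le.2 ⟨ht.1.le, ht.2⟩)
        _ = 0 + 2 / L := by rw [hδ]; ring
        _ ≤ c₁ / ℓ + 2 / L := by gcongr; positivity
        _ ≤ ρ := hedgeρ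
    · intro h
      have := congrArg Complex.re h
      simp at this
      rw [ha] at this
      have : (1 : ℝ) / L = 0 := by linarith
      exact hδ0.ne' (by rw [hδ]; exact this)
  -- pointwise: `Ψ(p) − Q1 · M(p) = (p − 1)^{−z} y^{1+p} (Q(p) − Q1)` and its norm
  have hpt : ∀ p : ℂ, p ≠ 1 → ‖p - 1‖ ≤ ρ →
      ‖Ψ p - Q1 * ((p - 1) ^ (-z) * (y : ℂ) ^ (1 + p))‖ ≤
        ‖(p - 1) ^ (-z)‖ * y ^ (1 + p.re) * (MQ * ‖p - 1‖) := by
    intro p hp1 hpρ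
    have hq := hQ z hz p hpρ
    rw [hΨ p, integrand_eq_cpow_mul y z hp1]
    have e : (p - 1) ^ (-z) * ((y : ℂ) ^ (1 + p) * (selbergF p z * (exp (z * logZeta₁ p) * kernel p))) -
        Q1 * ((p - 1) ^ (-z) * (y : ℂ) ^ (1 + p)) =
        (p - 1) ^ (-z) * (y : ℂ) ^ (1 + p) * (selbergF p z * (exp (z * logZeta₁ p) * kernel p) - Q1) := by
      ring
    rw [e, norm_mul, norm_mul, norm_cpow_eq_rpow_re_of_pos hy0, add_re, one_re]
    exact mul_le_mul_of_nonneg_left hq (by positivity)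
  -- integrability of the pieces on the three sides
  have hΨL : ∀ ε : ℝ, (ε = δ ∨ ε = -δ) →
      IntervalIntegrable (fun x : ℝ ↦ Ψ ((x : ℂ) + (ε : ℂ) * I)) volume b a := by
    intro ε hε
    refine Literature.Analysis.Complex.intervalIntegrable_horizontal_of_continuousOn hcontΨ ε hba
      fun x hx ↦ hslit _ ?_ ?_ ?_
    · simp only [add_im, ofReal_im, mul_im, ofReal_re, I_im, mul_one, I_re, mul_zero, add_zero, zero_add]
      rcases hε with rfl | rfl
      · rw [abs_of_pos hδ0]; exact hδT
      · rw [abs_neg, abs_of_pos hδ0]; exact hδT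
    · simpa using hx.1
    · simp only [add_im, ofReal_im, mul_im, ofReal_re, I_im, mul_one, I_re, mul_zero, add_zero, zero_add]
      rcases hε with rfl | rfl
      · exact hδ0.ne'
      · exact (neg_ne_zero.2 hδ0.ne')
  have hML : ∀ ε : ℝ, (ε = δ ∨ ε = -δ) →
      IntervalIntegrable (fun x : ℝ ↦ ((x : ℂ) + (ε : ℂ) * I - 1) ^ (-z) *
        (y : ℂ) ^ (1 + ((x : ℂ) + (ε : ℂ) * I))) volume b a := by
    intro ε hε
    refine Literature.Analysis.Complex.intervalIntegrable_horizontal_of_continuousOn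
      (F := fun s : ℂ ↦ (s - 1) ^ (-z) * (y : ℂ) ^ (1 + s)) hcontM ε hba fun x hx ↦ ?_
    refine mem_slitPlane_iff.2 (Or.inr ?_)
    simp only [sub_im, add_im, ofReal_im, mul_im, ofReal_re, I_im, mul_one, I_re, mul_zero, add_zero,
      zero_add, one_im, sub_zero]
    rcases hε with rfl | rfl
    · exact hδ0.ne'
    · exact (neg_ne_zero.2 hδ0.ne')
  have hΨR : IntervalIntegrable (fun t : ℝ ↦ Ψ ((a : ℂ) + (t : ℂ) * I)) volume (-δ) δ :=
    Literature.Analysis.Complex.intervalIntegrable_vertical_of_continuousOn hcontΨ a (by linarith)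
      fun t ht ↦ mem_zfrSlitRegion_of_one_lt_re (by simpa using ha1)
  have hMR : IntervalIntegrable (fun t : ℝ ↦ ((a : ℂ) + (t : ℂ) * I - 1) ^ (-z) *
      (y : ℂ) ^ (1 + ((a : ℂ) + (t : ℂ) * I))) volume (-δ) δ := by
    refine Literature.Analysis.Complex.intervalIntegrable_vertical_of_continuousOn
      (F := fun s : ℂ ↦ (s - 1) ^ (-z) * (y : ℂ) ^ (1 + s)) hcontM a (by linarith) fun t ht ↦ ?_
    refine mem_slitPlane_iff.2 (Or.inl ?_)
    simp only [sub_re, add_re, ofReal_re, mul_re, I_re, mul_zero, ofReal_im, I_im, mul_one, sub_self,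
      add_zero, one_re]
    linarith
  -- decomposition `∫ Ψ = Q1 ∫ M + ∫ (Ψ − Q1 M)` on each side
  have hdecL : ∀ ε : ℝ, (ε = δ ∨ ε = -δ) →
      ∫ x in b..a, Ψ ((x : ℂ) + (ε : ℂ) * I) =
        Q1 * (∫ x in b..a, ((x : ℂ) + (ε : ℂ) * I - 1) ^ (-z) * (y : ℂ) ^ (1 + ((x : ℂ) + (ε : ℂ) * I))) +
        ∫ x in b..a, (Ψ ((x : ℂ) + (ε : ℂ) * I) -
          Q1 * (((x : ℂ) + (ε : ℂ) * I - 1) ^ (-z) * (y : ℂ) ^ (1 + ((x : ℂ) + (ε : ℂ) * I)))) := by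
    intro ε hε
    rw [intervalIntegral.integral_sub (hΨL ε hε) ((hML ε hε).const_mul Q1),
      intervalIntegral.integral_const_mul]
    ring
  have hdecR : ∫ t in (-δ)..δ, Ψ ((a : ℂ) + (t : ℂ) * I) =
      Q1 * (∫ t in (-δ)..δ, ((a : ℂ) + (t : ℂ) * I - 1) ^ (-z) * (y : ℂ) ^ (1 + ((a : ℂ) + (t : ℂ) * I))) +
      ∫ t in (-δ)..δ, (Ψ ((a : ℂ) + (t : ℂ) * I) -
        Q1 * (((a : ℂ) + (t : ℂ) * I - 1) ^ (-z) * (y : ℂ) ^ (1 + ((a : ℂ) + (t : ℂ) * I)))) := by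
    rw [intervalIntegral.integral_sub hΨR (hMR.const_mul Q1), intervalIntegral.integral_const_mul]
    ring
  -- the main parts (substitution `s = 1 + w/L`)
  have hmainL : ∫ x in b..a, ((x : ℂ) + ((-δ : ℝ) : ℂ) * I - 1) ^ (-z) *
      (y : ℂ) ^ (1 + ((x : ℂ) + ((-δ : ℝ) : ℂ) * I)) =
      (y : ℂ) ^ 2 * (L : ℂ) ^ (z - 1) * ∫ u in (-β)..1, exp (((u : ℂ) - I) - z * log ((u : ℂ) - I)) :=
    integral_lower_edge_main hL0 b z
  have hmainU : ∫ x in b..a, ((x : ℂ) + (δ : ℂ) * I - 1) ^ (-z) *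
      (y : ℂ) ^ (1 + ((x : ℂ) + (δ : ℂ) * I)) =
      (y : ℂ) ^ 2 * (L : ℂ) ^ (z - 1) * ∫ u in (-β)..1, exp (((u : ℂ) + I) - z * log ((u : ℂ) + I)) :=
    integral_upper_edge_main hL0 b z
  have hmainR : ∫ t in (-δ)..δ, ((a : ℂ) + (t : ℂ) * I - 1) ^ (-z) *
      (y : ℂ) ^ (1 + ((a : ℂ) + (t : ℂ) * I)) =
      (y : ℂ) ^ 2 * (L : ℂ) ^ (z - 1) *
        ∫ v in (-1 : ℝ)..1, exp (((1 : ℂ) + (v : ℂ) * I) - z * log ((1 : ℂ) + (v : ℂ) * I)) :=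
    integral_right_edge_main hL0 z
  -- the edge errors
  have hRL : ‖∫ x in b..a, (Ψ ((x : ℂ) + ((-δ : ℝ) : ℂ) * I) -
      Q1 * (((x : ℂ) + ((-δ : ℝ) : ℂ) * I - 1) ^ (-z) * (y : ℂ) ^ (1 + ((x : ℂ) + ((-δ : ℝ) : ℂ) * I))))‖ ≤
      Kl * MQ * y ^ 2 * L ^ (z.re - 2) := by
    refine hlowerr L hL1 b hba z hz MQ hMQ _ fun x hx ↦ ?_
    obtain ⟨h1, h2⟩ := hρL x hx (-δ) (Or.inr rfl)
    have h := hpt _ h2 h1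
    have hre : ((x : ℂ) + ((-δ : ℝ) : ℂ) * I).re = x := by simp
    rw [hre] at h
    exact h
  have hRU : ‖∫ x in b..a, (Ψ ((x : ℂ) + (δ : ℂ) * I) -
      Q1 * (((x : ℂ) + (δ : ℂ) * I - 1) ^ (-z) * (y : ℂ) ^ (1 + ((x : ℂ) + (δ : ℂ) * I))))‖ ≤
      Ku * MQ * y ^ 2 * L ^ (z.re - 2) := by
    refine huperr L hL1 b hba z hz MQ hMQ _ fun x hx ↦ ?_
    obtain ⟨h1, h2⟩ := hρL x hx δ (Or.inl rfl)
    have h := hpt _ h2 h1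
    have hre : ((x : ℂ) + (δ : ℂ) * I).re = x := by simp
    rw [hre] at h
    exact h
  have hRR : ‖∫ t in (-δ)..δ, (Ψ ((a : ℂ) + (t : ℂ) * I) -
      Q1 * (((a : ℂ) + (t : ℂ) * I - 1) ^ (-z) * (y : ℂ) ^ (1 + ((a : ℂ) + (t : ℂ) * I))))‖ ≤
      Kr * MQ * y ^ 2 * L ^ (z.re - 2) := by
    refine hrighterr L hL1 z hz MQ hMQ _ fun t ht ↦ ?_
    obtain ⟨h1, h2⟩ := hρR t ht
    have h := hpt _ h2 h1
    have hre : ((a : ℂ) + (t : ℂ) * I).re = a := by simp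
    rw [hre] at h
    exact h
  ------------------------------------------------------------------
  -- Step E: Hankel's formula and the assembly
  ------------------------------------------------------------------
  have hH := hHankel β hβ1 z hz
  set η : ℂ := ((∫ u in (-β)..1, exp (((u : ℂ) - I) - z * log ((u : ℂ) - I))) -
      (∫ u in (-β)..1, exp (((u : ℂ) + I) - z * log ((u : ℂ) + I))) +
      I * ∫ v in (-1 : ℝ)..1, exp (((1 : ℂ) + (v : ℂ) * I) - z * log ((1 : ℂ) + (v : ℂ) * I))) -
      2 * π * I / Complex.Gamma z with hηdef
  -- the η-term
  have hdecη : Real.exp (-(zfrConst / 2 * Real.sqrt L)) ≤ C₄ * L ^ (-(1 : ℝ)) :=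
    exp_neg_le_of_rpow_le hL0 (hdec4 L hL1)
  have hηterm : ‖Q1 * (((y : ℂ)) ^ 2 * (L : ℂ) ^ (z - 1)) * η‖ ≤ B / 2 * CH * C₄ * y ^ 2 * L ^ (z.re - 2) := by
    have hny : ‖((y : ℂ)) ^ 2 * (L : ℂ) ^ (z - 1)‖ = y ^ 2 * L ^ (z.re - 1) := by
      rw [norm_mul, norm_pow, Complex.norm_real, Real.norm_of_nonneg hy0.le,
        norm_cpow_eq_rpow_re_of_pos hL0, sub_re, one_re]
    have hηb : ‖η‖ ≤ CH * (C₄ * L ^ (-(1 : ℝ))) := by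
      refine hH.trans (mul_le_mul_of_nonneg_left ?_ hCH)
      refine le_trans (Real.exp_le_exp.2 ?_) hdecη
      have := hβge
      linarith
    rw [norm_mul, norm_mul, hny]
    have h0 : 0 ≤ y ^ 2 * L ^ (z.re - 1) := by
      have := Real.rpow_nonneg hL0.le (z.re - 1); positivity
    calc ‖Q1‖ * (y ^ 2 * L ^ (z.re - 1)) * ‖η‖ ≤ (B / 2) * (y ^ 2 * L ^ (z.re - 1)) * (CH * (C₄ * L ^ (-(1 : ℝ)))) :=
          mul_le_mul (mul_le_mul_of_nonneg_right hQ1norm h0) hηb (norm_nonneg _) (by positivity)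
      _ = B / 2 * CH * C₄ * y ^ 2 * (L ^ (z.re - 1) * L ^ (-(1 : ℝ))) := by ring
      _ = B / 2 * CH * C₄ * y ^ 2 * L ^ (z.re - 2) := by
          rw [← Real.rpow_add hL0]; congr 2; ring
  -- the identity `I·J = 2πi·Main + E_total`
  have hIJ : I * ∫ t : ℝ, Ψ ((a : ℂ) + t * I) =
      2 * π * I * (Q1 / Complex.Gamma z * ((y : ℂ) ^ 2 * (L : ℂ) ^ (z - 1))) +
      (I * ((∫ t in Iic (-T), Ψ ((a : ℂ) + t * I)) + ∫ t in Ioi T, Ψ ((a : ℂ) + t * I)) +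
       I * ((∫ t in (-T)..(-δ), Ψ ((b : ℂ) + t * I)) + ∫ t in δ..T, Ψ ((b : ℂ) + t * I)) +
       ((∫ x in b..a, Ψ ((x : ℂ) + T * I)) - ∫ x in b..a, Ψ ((x : ℂ) + ((-T : ℝ) : ℂ) * I)) +
       (Q1 * (((y : ℂ)) ^ 2 * (L : ℂ) ^ (z - 1)) * η +
        ((∫ x in b..a, (Ψ ((x : ℂ) + ((-δ : ℝ) : ℂ) * I) -
            Q1 * (((x : ℂ) + ((-δ : ℝ) : ℂ) * I - 1) ^ (-z) * (y : ℂ) ^ (1 + ((x : ℂ) + ((-δ : ℝ) : ℂ) * I))))) +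
          I * (∫ t in (-δ)..δ, (Ψ ((a : ℂ) + (t : ℂ) * I) -
            Q1 * (((a : ℂ) + (t : ℂ) * I - 1) ^ (-z) * (y : ℂ) ^ (1 + ((a : ℂ) + (t : ℂ) * I))))) -
          ∫ x in b..a, (Ψ ((x : ℂ) + (δ : ℂ) * I) -
            Q1 * (((x : ℂ) + (δ : ℂ) * I - 1) ^ (-z) * (y : ℂ) ^ (1 + ((x : ℂ) + (δ : ℂ) * I))))))) := by
    rw [hkey, hdecL (-δ) (Or.inr rfl), hdecL δ (Or.inl rfl), hdecR, hmainL, hmainU, hmainR, hηdef]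
    ring
  -- `J = 2π·Main − i·E_total`, hence `Σ − Main = −(i/2π) E_total`
  set Etot : ℂ := I * ((∫ t in Iic (-T), Ψ ((a : ℂ) + t * I)) + ∫ t in Ioi T, Ψ ((a : ℂ) + t * I)) +
       I * ((∫ t in (-T)..(-δ), Ψ ((b : ℂ) + t * I)) + ∫ t in δ..T, Ψ ((b : ℂ) + t * I)) +
       ((∫ x in b..a, Ψ ((x : ℂ) + T * I)) - ∫ x in b..a, Ψ ((x : ℂ) + ((-T : ℝ) : ℂ) * I)) +
       (Q1 * (((y : ℂ)) ^ 2 * (L : ℂ) ^ (z - 1)) * η +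
        ((∫ x in b..a, (Ψ ((x : ℂ) + ((-δ : ℝ) : ℂ) * I) -
            Q1 * (((x : ℂ) + ((-δ : ℝ) : ℂ) * I - 1) ^ (-z) * (y : ℂ) ^ (1 + ((x : ℂ) + ((-δ : ℝ) : ℂ) * I))))) +
          I * (∫ t in (-δ)..δ, (Ψ ((a : ℂ) + (t : ℂ) * I) -
            Q1 * (((a : ℂ) + (t : ℂ) * I - 1) ^ (-z) * (y : ℂ) ^ (1 + ((a : ℂ) + (t : ℂ) * I))))) -
          ∫ x in b..a, (Ψ ((x : ℂ) + (δ : ℂ) * I) -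
            Q1 * (((x : ℂ) + (δ : ℂ) * I - 1) ^ (-z) * (y : ℂ) ^ (1 + ((x : ℂ) + (δ : ℂ) * I)))))) with hEtot
  have hJ : ∫ t : ℝ, Ψ ((a : ℂ) + t * I) =
      2 * π * (Q1 / Complex.Gamma z * ((y : ℂ) ^ 2 * (L : ℂ) ^ (z - 1))) - I * Etot := by
    linear_combination (-I) * hIJ +
      ((∫ t : ℝ, Ψ ((a : ℂ) + t * I)) - 2 * π * (Q1 / Complex.Gamma z * ((y : ℂ) ^ 2 * (L : ℂ) ^ (z - 1)))) *
        I_mul_I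
  have hπ : (π : ℂ) ≠ 0 := ofReal_ne_zero.2 Real.pi_ne_zero
  have hSigma : (∑ n ∈ Finset.Ioc 0 ⌊y⌋₊, omegaCoeff z n * ((y : ℂ) - n)) -
      selbergF 1 z / (2 * Complex.Gamma z) * ((y : ℂ)) ^ 2 * (L : ℂ) ^ (z - 1) =
      -(I / (2 * π)) * Etot := by
    have hP : (∑ n ∈ Finset.Ioc 0 ⌊y⌋₊, omegaCoeff z n * ((y : ℂ) - n)) =
        (1 / (2 * π) : ℂ) * ∫ t : ℝ, Ψ ((a : ℂ) + t * I) := hPerron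
    rw [hP, hJ, hQ1]
    field_simp
    ring
  -- the bound for `E_total`
  have hEtot_le : ‖Etot‖ ≤ CONST * y ^ 2 * L ^ (z.re - 2) := by
    have hRR' : ‖I * ∫ t in (-δ)..δ, (Ψ ((a : ℂ) + (t : ℂ) * I) -
        Q1 * (((a : ℂ) + (t : ℂ) * I - 1) ^ (-z) * (y : ℂ) ^ (1 + ((a : ℂ) + (t : ℂ) * I))))‖ ≤
        Kr * MQ * y ^ 2 * L ^ (z.re - 2) := by
      rw [norm_mul, Complex.norm_I, one_mul]; exact hRR
    have h1 := (norm_sub_le _ _).trans (add_le_add ((norm_add_le _ _).trans (add_le_add hRL hRR')) hRU)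
    have h2 := (norm_add_le _ _).trans (add_le_add hηterm h1)
    have h3 := (norm_add_le _ _).trans (add_le_add hTails hLeft)
    have h4 := (norm_add_le _ _).trans (add_le_add h3 hHoriz)
    have h5 := (norm_add_le _ _).trans (add_le_add h4 h2)
    rw [hEtot]
    refine h5.trans (le_of_eq ?_)
    rw [hCONST]
    ring
  -- conclusion
  rw [hSigma, norm_mul, norm_neg, norm_div, Complex.norm_I, norm_mul, Complex.norm_two, Complex.norm_real,
    Real.norm_of_nonneg Real.pi_pos.le]
  have h2π : 1 ≤ 2 * π := by linarith [Real.pi_gt_three]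
  calc 1 / (2 * π) * ‖Etot‖ ≤ 1 * ‖Etot‖ := by
        refine mul_le_mul_of_nonneg_right ?_ (norm_nonneg _)
        rw [div_le_iff₀ (by positivity)]; linarith
    _ = ‖Etot‖ := one_mul _
    _ ≤ CONST * y ^ 2 * L ^ (z.re - 2) := hEtot_le

end SatheSelberg

end Literature.NumberTheory.LFunctions
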